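import Literature.Analysis.FluidPDE.KolmogorovViscousLongWaveModes
import HarnessLib

/-!
# Long-wave modes of the passive solenoidal vector about one frozen Kolmogorov layer
# (Zel'dovich–Taylor shear dispersion, polarisation by polarisation)

Analysis/FluidPDE proof file (definitions with bodies + theorems; **no named facts**).  Companion of
`KolmogorovViscousLongWaveModes` (the `A = 1` problem: Navier–Stokes linearised at the Kolmogorov flow,
Meshalkin–Sinai's negative long-wave eddy viscosity) for the member `A = 0` of the passive-vector family
of Yoshida–Kaneda 2000, eq. (4)–(5) — the PASSIVE SOLENOIDAL VECTOR ("linear pressure model"; Kumar 2024,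
`∂ₜu + U·∇u = −∇p + νΔu`, `∇·u = ∇·U = 0`):

  `∂ₜw + (U·∇)w + ∇q = νΔw`, `∇·w = 0`   on `T³ = (ℝ/ℤ)³`, `U(x) = A sin(2πk x₁ + φ) e₀`

(one frozen Kolmogorov layer: shear wave vector `k e₁`, velocity along `e₀`; the weak, time-dependent
notion is `Torus.IsWeakPassiveVectorOn 0` of `PassiveVector.lean`).  The stretching term `(w·∇)U` of the
`A = 1` problem is absent, and with it the anti-viscous long-wave branch: what is left is Taylor–Zel'dovich
shear dispersion, resolved by polarisation.

## The Fourier chain and the decoupling of the polarisations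

`U` couples the Fourier coefficient `ŵ(κ)` only to `ŵ(κ ± k e₁)`, with a factor `2πi κ₀`
(`SteadyLattice.mFourierCoeff_convect_complex`, `KolmogorovShear.transportSym_shear_left`); so normal modes
live on lines `κ_m = (l, mk, j)`, `m ∈ ℤ` (`l ≥ 1` the wavenumber ALONG the layer velocity, `j` the
spanwise one).  The integer vector `u = (j, 0, −l)` is orthogonal to every `κ_m`, hence
`ŵ(κ_m) = η_m u` is divergence free for every scalar sequence `η`, the convective term `(U·∇)w` is again
of this form, and NO PRESSURE is generated: the `u`-polarised component of the passive solenoidal vector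
is a passive SCALAR (`w = u θ`, `θ` constant along `u`; for `j = 0` this is the observation of Kumar 2024,
§5 p. 18: "`U = (U₁(x₁,x₂), U₂(x₁,x₂), 0)`, `u = (0,0,u₃(x₁,x₂))` … the governing equation for `u₃` then
becomes the advection–diffusion equation").  In Chen–Price units (period `2π`, viscosity `1`, amplitude
`λ = A/(2πν)`; `KolmogorovViscousLongWaveModes`, §E) the coefficients `c_m` of a mode
`e^{−(ρ + j²)t} e^{i(lx + jz)} Σ_m c_m e^{imky}` of `∂ₜθ − Δθ + λ sin(ky) ∂ₓθ = 0` solve the three-term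
recurrence

  `(β_m − ρ) c_m + (λl/2)(c_{m−1} − c_{m+1}) = 0`,  `β_m = l² + m²k²`      (`IsScalarMode`)

— Chen–Price's chain (9) with the weight `α_{m±1}/β_m` replaced by the constant `l`: with `ρ = l² + E`
it reads `c_{m+1} − c_{m−1} = A_m c_m`, `A_m = 2(m²k² − E)/(λl)`, `A₀ < 0 < A_m` for `0 < E < k²`, which
is EXACTLY the shape handled by `KolmogorovViscous.exists_root` / `FriedlanderStraussVishik1997.exists_d`
(Meshalkin–Sinai continued fractions), now with the decay enhancement `E` in the role of the growth rate.
The other polarisation (`ŵ(κ_m) ∥ κ_m × u`, "in-plane": for `j = 0` the two-dimensional problem) obeys the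
bond-weighted chain `β_m(β_m − ρ)η_m + (λl/2)(γ_{m−1}η_{m−1} − γ_mη_{m+1}) = 0`, `γ_x = l² + x(x+1)k²`
(`= κ_x·κ_{x+1}`), recorded as `IsInPlaneMode`.

## What is proved

* `KolmogorovPassiveVector.exists_scalarMode` — **for integers `1 ≤ l`, `k` and every enhancement
  `0 < E ≤ k² − l` there is an amplitude `λ > 0` with
  `2E(k² − E)/l² ≤ λ² ≤ 2E(k² − E)/(l²(1 − E/(2(4k² − E))))` and a real, exponentially decaying
  sequence `c`, `c₀ ≠ 0`, solving the scalar chain with decay rate `ρ = l² + E`.**  To leading order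
  `E = λ²l²/(2k²)`: the decay rate of the wave `e^{ilx}` is `(1 + λ²/(2k²)) l²`, i.e. the effective
  diffusivity along the layer velocity is `κ_eff = κ(1 + Pe²/(2k²))` = `κ + U²/(2κk²)` — Zel'dovich's exact
  effective diffusivity of a sinusoidal shear (Zel'dovich 1982; Majda–Kramer 1999, §2.2.1.1 (50)–(51):
  `K̄ = Pe² Σ_k |v̂_k|²/(4π²k²)`), here as an exact normal mode at finite scale separation `l : k` with a
  two-sided error.
* `KolmogorovPassiveVector.exists_scalarMode_of_lt` — **conversely, for `2l ≤ k²` and EVERY amplitude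
  with `2λ²l² < k⁴` (long waves at fixed layer Péclet number `λ/k`: `(λ/k)·(l/k) < 1/√2`) there is an
  enhancement `0 < E < k²/2` in the same window carrying such a mode** (continuity of the continued
  fractions in `E`, intermediate value theorem — the argument of `KolmogorovViscous.exists_growingMode`).
* `Torus.passiveVectorOperator A ν U`, `Torus.IsPassiveVectorEigenvalue A ν U μ` — the classical point
  spectrum of the generator `νΔw − (U·∇)w − A(w·∇)U − ∇q` (`div w = 0`, `∫w = 0`) of the Yoshida–Kaneda
  family, `A = 1` being `Torus.IsLinNSEigenvalue` (`isPassiveVectorEigenvalue_one_iff`).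
* `KolmogorovPassiveVector.isPassiveVectorEigenvalue_of_isScalarMode` — **the dictionary**: for a smooth
  real `U : T³ → ℝ³` with Fourier support `{±k e₁}` and values parallel to `e₀` (`U = A sin(2πkx₁ + φ)e₀`,
  `A = 2|Û(ke₁)₀|`), `ν > 0`, `λ = A/(2πν)`, a scalar chain mode of decay rate `ρ` gives, for every
  spanwise `j ∈ ℤ`, the eigenvalue `μ = −4π²ν(ρ + j²)` of the `A = 0` operator, with the `u`-polarised,
  pressure-free eigenfunction `ŵ(l, mk, j) = (iz/|z|)^m c_m (j, 0, −l)`.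
* `KolmogorovPassiveVector.exists_eigenvalue_taylorWindow` — **headline**: for such `U`, `ν`, integers
  `1 ≤ l`, `2l ≤ k²`, `j`, and `2λ²l² < k⁴`, the passive solenoidal vector about `U` has a real eigenvalue
  `μ = −4π²ν(l² + j² + E)` with `E(k² − E) ∈ [λ²l²(1 − E/(2(4k²−E)))/2, λ²l²/2]`: decay rate
  `4π²ν(l² + j²) + [A²l²/(2νk²)](1 + O(E/k²))` — enhancement `c_F (ê·q)²`, `c_F = A²/(2ν k_U²)`
  (`k_U = 2πk`, `q = 2π(l, 0, j)`, `ê = e₀`), i.e. the coefficients `1` (`j = 0`) and `½` (`j = ±l`) of the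
  cell tensor of one layer, relative to `|q|²`; NEVER anti-diffusive.
* `KolmogorovPassiveVector.taylorWindow_sandwich`, `exists_eigenvalue_taylorSandwich` — the same window in
  the form `(13/28)·λ²l²/k² ≤ E ≤ λ²l²/k²` (within the factors `13/14` and `2` of the Zel'dovich–Taylor
  value `λ²l²/(2k²)`).
* `KolmogorovPassiveVector.isPassiveVectorEigenvalue_transverse` — the sector `κ₀ = 0` (`q ⊥ ê`): every
  divergence-free Fourier mode `e^{2πiκ·x} p` is an exact eigenfunction with the bare eigenvalue
  `−4π²ν|κ|²` (coefficient `0`).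
* `KolmogorovPassiveVector.sq_le_re_of_isScalarModeC`, `sq_le_re_of_isInPlaneModeC` — **no negative eddy
  viscosity at `A = 0`, for either polarisation, at every amplitude**: every exponentially localised
  complex solution `c ≢ 0` of either chain (complex rate `ρ`) has `Re ρ ≥ l²` — precisely
  `Re ρ · Σ|c_m|² = Σ β_m|c_m|²` (scalar) and `Re ρ · Σ β_m|η_m|² = Σ β_m²|η_m|²` (in-plane): the energy
  identity `d/dt ½‖w‖² = −ν‖∇w‖²` of the passive solenoidal vector at the level of normal modes (§3;
  contrast `KolmogorovViscous.exists_growingMode` at `A = 1`).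

NOT proved here: the Taylor window for the in-plane polarisation (its bond weights `γ` do not reduce to
the Friedlander–Strauss–Vishik normal form by a diagonal substitution; formally its second-order
coefficient at `j = 0` is `λ²l⁴/(2k²(l² + k²)) = O(l⁴)` — no `O(l²)` enhancement in the axis sector),
uniqueness / simplicity of the slow branch, completeness, and the passage from classical eigenfunctions
to the weak time-dependent notion `Torus.IsWeakPassiveVectorOn 0`.

## References

* Ya. B. Zel'dovich, *Exact solution of the problem of diffusion in a periodic velocity field, and
  turbulent diffusion*, Sov. Phys. Dokl. 27 (1982) 797–799. [`Zeldovich1982`]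
* A. J. Majda, P. R. Kramer, *Simplified models for turbulent diffusion*, Phys. Rep. 314 (1999)
  237–574, §2.2.1.1 eq. (49)–(51), pp. 264–265 (held: `paper:doi-10-1016-s0370-1573-98-00083-0`,
  p0027–p0028). [`MajdaKramer1999`]
* K. Yoshida, Y. Kaneda, Phys. Rev. E 63 (2000) 016308, §II (4)–(5). [`YoshidaKaneda2000`]
* A. Kumar, *Almost anomalous dissipation in advection-diffusion of a divergence-free passive vector*,
  arXiv:2409.15000 (2024), §1 (the model), §5 p. 18 (the `2½`-dimensional reduction). [`Kumar2024`]
* Z.-M. Chen, W. G. Price, J. Stat. Phys. 86 (1997) 301–335, §2 (9)–(14) (the chain and the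
  continued-fraction method re-used here). [`ChenPrice1997`]
* L. D. Meshalkin, Ya. G. Sinai, J. Appl. Math. Mech. 25 (1961) 1700–1705. [`MeshalkinSinai1961`]
-/

noncomputable section

open Filter
open scoped Topology

namespace Literature.Analysis.FluidPDE

/-! ## 0. The classical point spectrum of the passive-vector family (Yoshida–Kaneda `(α, β) = (A, 1)`) -/

namespace Torus

open Literature.Analysis.FunctionSpaces

variable {d : Type*} [Fintype d] [DecidableEq d]

/-- **The generator of the passive-vector family with stretching coefficient `A`**, as the classical
differential expression on a complex velocity–pressure pair:
`L_A(ν, U)(w, q)(x) = νΔw(x) − (U·∇)w(x) − A (w·∇)U(x) − ∇q(x)` — the right-hand side of Yoshida–Kaneda's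
eq. (4) `∂ₜũ + (v·∇)ũ − νΔũ = −α(ũ·∇)v − β∇p̃` with `(α, β) = (A, 1)`; `A = 1` is the linearised
Navier–Stokes operator `Torus.linearizedNSOperator`, `A = 0` the passive solenoidal vector.
[cite: YoshidaKaneda2000, §II eq. (4)-(5)] -/
def passiveVectorOperator (A ν : ℝ) (U : UnitAddTorus d → EuclideanSpace ℝ d)
    (w : UnitAddTorus d → EuclideanSpace ℂ d) (q : UnitAddTorus d → ℂ) (x : UnitAddTorus d) :
    EuclideanSpace ℂ d :=
  ν • FunctionSpaces.Torus.laplacian w x -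
    (FunctionSpaces.Torus.convect U w x + (A : ℂ) • stretch w U x) - gradientC q x

/-- **`μ ∈ ℂ` is an eigenvalue of the passive-vector operator `L_A(ν, U)`** (classical point spectrum of
the complexification, as in `Torus.IsLinNSEigenvalue`): there is a non-zero smooth divergence-free
mean-zero `w` and a smooth `q` with `νΔw − (U·∇)w − A(w·∇)U − ∇q = μ w` on `T^d`.
[cite: YoshidaKaneda2000, §II eq. (4)-(5)] -/
def IsPassiveVectorEigenvalue (A ν : ℝ) (U : UnitAddTorus d → EuclideanSpace ℝ d) (μ : ℂ) : Prop :=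
  ∃ w : UnitAddTorus d → EuclideanSpace ℂ d, w ≠ 0 ∧ FunctionSpaces.Torus.IsSmooth w ∧ IsDivFreeC w ∧
    FunctionSpaces.Torus.HasZeroMean w ∧ ∃ q : UnitAddTorus d → ℂ, FunctionSpaces.Torus.IsSmooth q ∧
      ∀ x, passiveVectorOperator A ν U w q x - μ • w x = 0

/-- Unfolding `passiveVectorOperator`: Yoshida–Kaneda's right-hand side `νΔw − (U·∇)w − A(w·∇)U − ∇q`.
[cite: YoshidaKaneda2000, §II eq. (4)-(5)] -/
theorem passiveVectorOperator_apply (A ν : ℝ) (U : UnitAddTorus d → EuclideanSpace ℝ d)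
    (w : UnitAddTorus d → EuclideanSpace ℂ d) (q : UnitAddTorus d → ℂ) (x : UnitAddTorus d) :
    passiveVectorOperator A ν U w q x =
      ν • FunctionSpaces.Torus.laplacian w x -
        (FunctionSpaces.Torus.convect U w x + (A : ℂ) • stretch w U x) - gradientC q x := rfl

/-- `A = 1` is the linearised Navier–Stokes operator. [cite: YoshidaKaneda2000, §II eq. (4)-(5) ((α,β)=(1,1))] -/
theorem passiveVectorOperator_one (ν : ℝ) (U : UnitAddTorus d → EuclideanSpace ℝ d)
    (w : UnitAddTorus d → EuclideanSpace ℂ d) (q : UnitAddTorus d → ℂ) (x : UnitAddTorus d) :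
    passiveVectorOperator 1 ν U w q x = linearizedNSOperator ν U w q x := by
  rw [passiveVectorOperator_apply, linearizedNSOperator_apply, Complex.ofReal_one, one_smul]

/-- At `A = 1` the eigenvalues of the passive-vector operator are those of the linearised Navier–Stokes
operator `Torus.IsLinNSEigenvalue`. [cite: YoshidaKaneda2000, §II eq. (4)-(5) ((α,β)=(1,1))] -/
theorem isPassiveVectorEigenvalue_one_iff (ν : ℝ) (U : UnitAddTorus d → EuclideanSpace ℝ d) (μ : ℂ) :
    IsPassiveVectorEigenvalue 1 ν U μ ↔ IsLinNSEigenvalue ν U μ := by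
  constructor
  · rintro ⟨w, hw0, hw, hdiv, hmean, q, hq, h⟩
    refine ⟨w, hw0, hw, hdiv, hmean, q, hq, fun x => ?_⟩
    rw [← passiveVectorOperator_one, h x, Pi.zero_apply]
  · rintro ⟨w, hw0, hw, hdiv, hmean, q, hq, h⟩
    refine ⟨w, hw0, hw, hdiv, hmean, q, hq, fun x => ?_⟩
    rw [passiveVectorOperator_one, h x, Pi.zero_apply]

end Torus

/-! ## 1. The scalar chain (the `u`-polarisation) and its Taylor window -/

namespace KolmogorovPassiveVector

open FriedlanderStraussVishik1997 KolmogorovViscous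

/-- **The scalar chain.** A real sequence `c` on `ℤ` is a mode of the passive scalar
`∂ₜθ − Δθ + λ sin(ky)∂ₓθ = 0` on `[0,2π]²` (viscosity `1`, shear amplitude = Péclet number `λ`, shear
wavenumber `k`, wavenumber `l` along the flow, decay rate `ρ`: the mode is
`e^{−ρt} e^{ilx} Σ_m c_m e^{imky}`) when `(λl/2)(c_{m−1} − c_{m+1}) + (β_m − ρ) c_m = 0` for every `m`,
`β_m = l² + m²k²` (`KolmogorovViscous.cpW`).  This is also the chain of the `u`-polarised component of the
passive solenoidal vector about the layer (module docstring; Kumar 2024, §5 p. 18).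
[cite: MajdaKramer1999, §2.2.1.1 eq. (49) (the shear-flow cell problem); ChenPrice1997, §2 (9)] -/
def IsScalarMode (k l lam ρ : ℝ) (c : ℤ → ℝ) : Prop :=
  ∀ m : ℤ, lam * l * (c (m - 1) - c (m + 1)) / 2 + (cpW k l m - ρ) * c m = 0

/-- The bond weight `γ_x = l² + x(x+1)k² = κ_x · κ_{x+1}` (`κ_x = (l, xk)`) of the in-plane chain. [folklore] -/
def bond (k l x : ℝ) : ℝ := l ^ 2 + x * (x + 1) * k ^ 2

/-- **The in-plane chain.** A real sequence `η` on `ℤ` is an in-plane mode of the passive solenoidal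
vector about the layer `λ sin(ky) eₓ` on `[0,2π]²` (viscosity `1`; velocity coefficients
`ŵ(l, mk) = η_m (mk, −l)`, decay rate `ρ`) when
`(λl/2)(γ_{m−1}η_{m−1} − γ_m η_{m+1}) + β_m(β_m − ρ)η_m = 0` for every `m` (project the coefficient
equation at `κ_m` onto `κ_m^⊥ = (mk, −l)`: `(mk,−l)·((m∓1)k,−l) = γ_{m−1}, γ_m`, `|(mk,−l)|² = β_m`).
[cite: Kumar2024, §1 (the passive-vector model); YoshidaKaneda2000, §II eq. (4)-(5)] -/
def IsInPlaneMode (k l lam ρ : ℝ) (η : ℤ → ℝ) : Prop :=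
  ∀ m : ℤ, lam * l * (bond k l ((m : ℝ) - 1) * η (m - 1) - bond k l m * η (m + 1)) / 2 +
    cpW k l m * (cpW k l m - ρ) * η m = 0

/-! ### The elements of the scalar chain in Friedlander–Strauss–Vishik form -/

/-- The elements `bₙ = 2((n+1)²k² − E)/l` of the scalar chain at enhancement `E` are `≥ 2` as soon as
`E + l ≤ k²`. [folklore] -/
private theorem two_le_elt {k l E : ℝ} (hl : 1 ≤ l) (hE : E + l ≤ k ^ 2) (n : ℕ) :
    2 ≤ 2 * (((n : ℝ) + 1) ^ 2 * k ^ 2 - E) / l := by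
  have hl0 : 0 < l := by linarith
  rw [le_div_iff₀ hl0]
  have hn : (1 : ℝ) ≤ ((n : ℝ) + 1) ^ 2 := by nlinarith [(Nat.cast_nonneg n : (0 : ℝ) ≤ n)]
  have hk : 0 ≤ k ^ 2 := sq_nonneg k
  nlinarith [mul_le_mul_of_nonneg_right hn hk]

/-- Two-sided bounds at a root of the characteristic equation `v₀ = c₀σ` of a positive chain: the first
two truncations of the continued fraction give `1 − c₀/b₁ ≤ σ²c₀b₀ ≤ 1`. [cite: ChenPrice1997, §2, proof of Lemma 2.2 ((15)–(17))] -/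
private theorem root_bounds {β : ℕ → ℝ} {T : ℝ → ℕ → ℕ → ℝ}
    (H : (∀ n, 2 ≤ β n) ∧ (∀ σ n, T σ 0 n = 0) ∧ ∀ σ N n, T σ (N + 1) n = 1 / (σ * β n + T σ N (n + 1)))
    {σ : ℝ} (hσ : 0 < σ) {v : ℕ → ℝ} (hv : ∀ n, Tendsto (fun N => T σ N n) atTop (𝓝 (v n)))
    {c₀ : ℝ} (hroot : v 0 = c₀ * σ) :
    σ ^ 2 * (c₀ * β 0) ≤ 1 ∧ 1 - c₀ / β 1 ≤ σ ^ 2 * (c₀ * β 0) := by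
  have hb0 : 0 < β 0 := by linarith [H.1 0]
  have hb1 : 0 < β 1 := by linarith [H.1 1]
  obtain ⟨-, hle, hrel⟩ := cf_limit_props H hσ hv 0
  obtain ⟨hpos1, hle1, -⟩ := cf_limit_props H hσ hv 1
  constructor
  · rw [hroot, le_div_iff₀ (mul_pos hσ hb0)] at hle
    nlinarith
  · have hD : 0 < σ * β 0 + 1 / (σ * β 1) := by positivity
    have hlow : 1 / (σ * β 0 + 1 / (σ * β 1)) ≤ c₀ * σ := by
      rw [← hroot, hrel]
      exact one_div_le_one_div_of_le (by positivity) (by linarith)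
    rw [div_le_iff₀ hD] at hlow
    have e1 : c₀ * σ * (σ * β 0 + 1 / (σ * β 1)) = σ ^ 2 * (c₀ * β 0) + c₀ / β 1 := by
      field_simp
    rw [e1] at hlow
    linarith

/-- **From a root of the characteristic equation to a scalar mode.** For the chain elements
`bₙ = 2((n+1)²k² − E)/l` at `σ = 1/λ`: if the tails `vₙ` of `1/(σb₀ + 1/(σb₁ + ⋯))` satisfy
`v₀ = (E/l)σ`, then the two-sided sequence `d` of `FriedlanderStraussVishik1997.exists_d` is an
exponentially decaying scalar mode with decay rate `l² + E` and `d₀ = 1`.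
[cite: ChenPrice1997, §2 (11)–(14) (continued-fraction construction of the mode)] -/
private theorem scalarMode_of_root {k : ℝ} {l : ℕ} (hl : 1 ≤ l) {E : ℝ}
    {β : ℕ → ℝ} (hβdef : ∀ n, β n = 2 * (((n : ℝ) + 1) ^ 2 * k ^ 2 - E) / l)
    {T : ℝ → ℕ → ℕ → ℝ} (H : (∀ n, 2 ≤ β n) ∧ (∀ σ n, T σ 0 n = 0) ∧
      ∀ σ N n, T σ (N + 1) n = 1 / (σ * β n + T σ N (n + 1)))
    {σ : ℝ} (hσ : 0 < σ) {v : ℕ → ℝ} (hv : ∀ n, Tendsto (fun N => T σ N n) atTop (𝓝 (v n)))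
    (hchar : v 0 = E / l * σ) :
    ∃ c : ℤ → ℝ, c 0 ≠ 0 ∧
      (∃ K r : ℝ, 0 ≤ K ∧ 0 < r ∧ r < 1 ∧ ∀ m : ℤ, |c m| ≤ K * r ^ m.natAbs) ∧
      IsScalarMode k l (1 / σ) ((l : ℝ) ^ 2 + E) c := by
  have hl' : (1 : ℝ) ≤ l := by exact_mod_cast hl
  have hl0 : (0 : ℝ) < l := by linarith
  have hprops := cf_limit_props H hσ hv
  obtain ⟨d, hd0, hd01, hpos, hneg, -, -, K, r, hK, hr0, hr1, hdec⟩ :=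
    exists_d H.1 hσ (fun n => (hprops n).1) (fun n => (hprops n).2.1) (fun n => (hprops n).2.2)
  -- the recurrence d_{m+1} − d_{m−1} = (2(m²k² − E)σ/l) d_m at every integer
  have hzero : d (0 + 1) - d (0 - 1) = 2 * ((0 : ℝ) ^ 2 * k ^ 2 - E) * σ / l * d 0 := by
    rw [zero_add, zero_sub, hd01, hd0, hchar]
    field_simp
    ring
  have hrec : ∀ m : ℤ, d (m + 1) - d (m - 1) = 2 * ((m : ℝ) ^ 2 * k ^ 2 - E) * σ / l * d m := by
    intro m
    obtain ⟨n, rfl | rfl⟩ := m.eq_nat_or_neg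
    · cases n with
      | zero => push_cast; exact hzero
      | succ n =>
        push_cast
        rw [show (n : ℤ) + 1 + 1 = n + 2 by ring, show (n : ℤ) + 1 - 1 = n by ring, hpos n, hβdef]
        field_simp
    · cases n with
      | zero => push_cast; simp only [neg_zero]; exact hzero
      | succ n =>
        push_cast
        rw [show -((n : ℤ) + 1) + 1 = -(n : ℤ) by ring,
          show -((n : ℤ) + 1) - 1 = -(n : ℤ) - 2 by ring,
          show -((n : ℤ) + 1) = -(n : ℤ) - 1 by ring, hneg n, hβdef]
        field_simp
  refine ⟨d, by rw [hd0]; exact one_ne_zero, ⟨K, r, hK, hr0, hr1, hdec⟩, fun m => ?_⟩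
  -- the chain with ρ = l² + E
  have e1 : cpW k l m - ((l : ℝ) ^ 2 + E) = (m : ℝ) ^ 2 * k ^ 2 - E := by unfold cpW; ring
  rw [e1, show d (m - 1) - d (m + 1) = -(d (m + 1) - d (m - 1)) by ring, hrec m]
  field_simp
  ring

/-- **A scalar mode for every enhancement in range (Zel'dovich–Taylor shear dispersion as an exact normal
mode).** For integers `1 ≤ l`, `k` and every decay enhancement `E` with `0 < E`, `E + l ≤ k²` there is a
Péclet number `λ > 0` with
`2E(k² − E)/l² ≤ λ²` and `λ²(1 − E/(2(4k² − E))) ≤ 2E(k² − E)/l²`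
at which the passive scalar in the shear `λ sin(ky) eₓ` on `[0,2π]²` (diffusivity `1`) has the normal
mode `e^{−(l² + E)t} e^{ilx} Σ_m c_m e^{imky}`, `c` real, `c₀ ≠ 0`, exponentially decaying.  To leading
order `E = λ²l²/(2k²)`, i.e. the effective diffusivity along the flow is `1 + λ²/(2k²)` = `κ + U²/(2κk²)`
— Zel'dovich's formula, Majda–Kramer (51) `K̄ = Pe² Σ_k |v̂_k|²/(4π²k²)` for `v = sin` — with the
two-sided error displayed.  Proof: Meshalkin–Sinai continued fractions exactly as in
`KolmogorovViscous.exists_mode`: the chain is `c_{m+1} − c_{m−1} = (2(m²k² − E)/(λl)) c_m`, negative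
coefficient at `m = 0` only, elements `bₙ = 2((n+1)²k² − E)/l ≥ 2`, characteristic equation
`u₀(σ) = (E/l)σ` (`KolmogorovViscous.exists_root`).
[cite: MajdaKramer1999, §2.2.1.1 eq. (50)-(51); Zeldovich1982; ChenPrice1997, §2 (9)–(14)] -/
theorem exists_scalarMode {k l : ℕ} (hl : 1 ≤ l) {E : ℝ} (hE : 0 < E) (hEk : E + l ≤ (k : ℝ) ^ 2) :
    ∃ lam : ℝ, 0 < lam ∧ 2 * E * ((k : ℝ) ^ 2 - E) / (l : ℝ) ^ 2 ≤ lam ^ 2 ∧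
      lam ^ 2 * (1 - E / (2 * (4 * (k : ℝ) ^ 2 - E))) ≤ 2 * E * ((k : ℝ) ^ 2 - E) / (l : ℝ) ^ 2 ∧
      ∃ c : ℤ → ℝ, c 0 ≠ 0 ∧
        (∃ K r : ℝ, 0 ≤ K ∧ 0 < r ∧ r < 1 ∧ ∀ m : ℤ, |c m| ≤ K * r ^ m.natAbs) ∧
        IsScalarMode k l lam ((l : ℝ) ^ 2 + E) c := by
  have hl' : (1 : ℝ) ≤ l := by exact_mod_cast hl
  have hl0 : (0 : ℝ) < l := by linarith
  have hkE : 0 < (k : ℝ) ^ 2 - E := by linarith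
  -- the elements, truncations and limits
  obtain ⟨β, hβdef⟩ : ∃ β : ℕ → ℝ, ∀ n, β n = 2 * (((n : ℝ) + 1) ^ 2 * (k : ℝ) ^ 2 - E) / l :=
    ⟨_, fun n => rfl⟩
  have hβ : ∀ n, 2 ≤ β n := fun n => by rw [hβdef]; exact two_le_elt hl' hEk n
  obtain ⟨T, hT0, hTs⟩ : ∃ T : ℝ → ℕ → ℕ → ℝ, (∀ σ n, T σ 0 n = 0) ∧
      ∀ σ N n, T σ (N + 1) n = 1 / (σ * β n + T σ N (n + 1)) :=
    ⟨fun σ N => Nat.rec (motive := fun _ => ℕ → ℝ) (fun _ => 0)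
        (fun _ ih n => 1 / (σ * β n + ih (n + 1))) N, fun _ _ => rfl, fun _ _ _ => rfl⟩
  have H : (∀ n, 2 ≤ β n) ∧ (∀ σ n, T σ 0 n = 0) ∧
      ∀ σ N n, T σ (N + 1) n = 1 / (σ * β n + T σ N (n + 1)) := ⟨hβ, hT0, hTs⟩
  obtain ⟨u, hu⟩ := cf_exists_limit H
  -- the characteristic equation u₀(σ) = (E/l) σ
  have hc0 : 0 < E / l := div_pos hE hl0
  have hβ0 : β 0 = 2 * ((k : ℝ) ^ 2 - E) / l := by rw [hβdef 0]; push_cast; ring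
  have hβ1 : β 1 = 2 * (4 * (k : ℝ) ^ 2 - E) / l := by rw [hβdef 1]; push_cast; ring
  have hcb : E / l < β 1 := by
    rw [hβ1, div_lt_div_iff_of_pos_right hl0]
    nlinarith
  obtain ⟨σ, hσ, hchar, hup, hlow⟩ := exists_root H hu hc0 hcb
  obtain ⟨c, hc0', hdec, hmode⟩ := scalarMode_of_root (k := (k : ℝ)) hl hβdef H hσ (hu σ hσ) (by rw [hchar])
  have e : E / l * β 0 = 2 * E * ((k : ℝ) ^ 2 - E) / (l : ℝ) ^ 2 := by
    rw [hβ0]; field_simp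
  have e' : E / l / β 1 = E / (2 * (4 * (k : ℝ) ^ 2 - E)) := by
    rw [hβ1]; field_simp
  refine ⟨1 / σ, one_div_pos.2 hσ, ?_, ?_, c, hc0', hdec, hmode⟩
  · rw [← e, one_div_pow, le_div_iff₀ (pow_pos hσ 2)]
    calc E / l * β 0 * σ ^ 2 = σ ^ 2 * (E / l * β 0) := by ring
      _ ≤ 1 := hup
  · rw [← e, ← e', one_div_pow, div_mul_eq_mul_div, one_mul, div_le_iff₀ (pow_pos hσ 2)]
    calc 1 - E / l / β 1 ≤ σ ^ 2 * (E / l * β 0) := hlow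
      _ = E / l * β 0 * σ ^ 2 := by ring

/-- **A scalar mode for every amplitude below the double-point scale (`2λ²l² < k⁴`).** For integers
`1 ≤ l`, `2l ≤ k²` and every Péclet number `λ > 0` with `2λ²l² < k⁴` the passive scalar in the shear
`λ sin(ky) eₓ` on `[0,2π]²` has a normal mode `e^{−(l² + E)t} e^{ilx} Σ_m c_m e^{imky}` (`c` real,
exponentially decaying, `c₀ ≠ 0`) whose decay enhancement `E` lies in the Taylor window
`0 < E < k²/2`, `2E(k² − E) ≤ λ²l²`, `λ²l²(1 − E/(2(4k² − E))) ≤ 2E(k² − E)` — so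
`E = (λ²l²/(2k²))(1 + O(λ²l²/k⁴))`, the normal-mode form of the effective diffusivity `κ + U²/(2κk²)`
(Zel'dovich 1982; Majda–Kramer (51)).  Proof: at fixed `σ = 1/λ` the characteristic function
`G(E) = u₀^{(E)}(σ) − (E/l)σ` is continuous on `[0, k²/2]` (the truncated continued fractions converge
uniformly, their elements `2((n+1)²k² − E)/l` being affine in `E` and `≥ 2` for `E ≤ k²/2 ≤ k² − l`),
`G(0) = u₀ > 0`, and `G(k²/2) < 0` by the first truncation `u₀ ≤ 1/(σb₀) = l/(σk²)` (this is the
hypothesis `2λ²l² < k⁴`); intermediate value theorem, then the bounds from the first two truncations.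
[cite: MajdaKramer1999, §2.2.1.1 eq. (50)-(51); Zeldovich1982; ChenPrice1997, §2 (9)–(14)] -/
theorem exists_scalarMode_of_lt {k l : ℕ} (hl : 1 ≤ l) (h2 : 2 * l ≤ k ^ 2)
    {lam : ℝ} (hlam : 0 < lam) (hpe : 2 * lam ^ 2 * (l : ℝ) ^ 2 < (k : ℝ) ^ 4) :
    ∃ E : ℝ, 0 < E ∧ 2 * E < (k : ℝ) ^ 2 ∧
      2 * E * ((k : ℝ) ^ 2 - E) ≤ lam ^ 2 * (l : ℝ) ^ 2 ∧
      lam ^ 2 * (l : ℝ) ^ 2 * (1 - E / (2 * (4 * (k : ℝ) ^ 2 - E))) ≤ 2 * E * ((k : ℝ) ^ 2 - E) ∧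
      ∃ c : ℤ → ℝ, c 0 ≠ 0 ∧
        (∃ K r : ℝ, 0 ≤ K ∧ 0 < r ∧ r < 1 ∧ ∀ m : ℤ, |c m| ≤ K * r ^ m.natAbs) ∧
        IsScalarMode k l lam ((l : ℝ) ^ 2 + E) c := by
  -- real casts of the integer parameters
  have hl' : (1 : ℝ) ≤ l := by exact_mod_cast hl
  have hl0 : (0 : ℝ) < l := by linarith
  have h2' : 2 * (l : ℝ) ≤ (k : ℝ) ^ 2 := by exact_mod_cast h2
  have hk0 : (0 : ℝ) < (k : ℝ) ^ 2 := by linarith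
  set Emax : ℝ := (k : ℝ) ^ 2 / 2 with hEmax
  have hEmax0 : 0 < Emax := by rw [hEmax]; positivity
  have hEl : ∀ E, E ≤ Emax → E + l ≤ (k : ℝ) ^ 2 := fun E hE => by rw [hEmax] at hE; linarith
  set σ : ℝ := 1 / lam with hσdef
  have hσ : 0 < σ := by rw [hσdef]; exact one_div_pos.2 hlam
  -- the `E`-family of chains: elements, truncations, limits
  obtain ⟨βf, hβf⟩ : ∃ βf : ℝ → ℕ → ℝ, ∀ E n, βf E n = 2 * (((n : ℝ) + 1) ^ 2 * (k : ℝ) ^ 2 - E) / l :=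
    ⟨_, fun E n => rfl⟩
  obtain ⟨Tf, hTf0, hTfs⟩ : ∃ Tf : ℝ → ℝ → ℕ → ℕ → ℝ, (∀ E σ' n, Tf E σ' 0 n = 0) ∧
      ∀ E σ' N n, Tf E σ' (N + 1) n = 1 / (σ' * βf E n + Tf E σ' N (n + 1)) :=
    ⟨fun E σ' N => Nat.rec (motive := fun _ => ℕ → ℝ) (fun _ => 0)
        (fun _ ih n => 1 / (σ' * βf E n + ih (n + 1))) N, fun _ _ _ => rfl, fun _ _ _ _ => rfl⟩
  have Hf : ∀ E, E ≤ Emax → (∀ n, 2 ≤ βf E n) ∧ (∀ σ' n, Tf E σ' 0 n = 0) ∧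
      ∀ σ' N n, Tf E σ' (N + 1) n = 1 / (σ' * βf E n + Tf E σ' N (n + 1)) := fun E hE =>
    ⟨fun n => by rw [hβf]; exact two_le_elt hl' (hEl E hE) n, hTf0 E, hTfs E⟩
  obtain ⟨uf, huf⟩ : ∃ uf : ℝ → ℝ → ℕ → ℝ, ∀ E, E ≤ Emax → ∀ σ', 0 < σ' → ∀ n,
      Tendsto (fun N => Tf E σ' N n) atTop (𝓝 (uf E σ' n)) :=
    ⟨fun E σ' n => limUnder atTop fun N => Tf E σ' N n,
      fun E hE σ' hσ' n => (cf_cauchySeq (Hf E hE) hσ' n).tendsto_limUnder⟩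
  -- continuity of E ↦ Tf E σ N n on (−∞, Emax]
  have hTcont : ∀ N n, ContinuousOn (fun E => Tf E σ N n) (Set.Iic Emax) := by
    intro N
    induction N with
    | zero => intro n; simp only [hTf0]; exact continuousOn_const
    | succ N ih =>
      intro n
      have h : (fun E => Tf E σ (N + 1) n) = fun E => 1 / (σ * βf E n + Tf E σ N (n + 1)) :=
        funext fun E => hTfs E σ N n
      rw [h]
      have hβcont : Continuous fun E => βf E n := by
        have e : (fun E => βf E n) = fun E => 2 * (((n : ℝ) + 1) ^ 2 * (k : ℝ) ^ 2 - E) / l :=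
          funext fun E => hβf E n
        rw [e]
        exact ((continuous_const.mul (continuous_const.sub continuous_id)).div_const _)
      refine ContinuousOn.div continuousOn_const
        ((continuousOn_const.mul hβcont.continuousOn).add (ih (n + 1))) fun E hE => ?_
      have h1 := (cf_bounds (Hf E hE) (σ := σ) hσ N (n + 1)).1
      have h2 : 0 < σ * βf E n := mul_pos hσ (by linarith [(Hf E hE).1 n])
      exact (add_pos_of_pos_of_nonneg h2 h1).ne'
  -- continuity of E ↦ uf E σ 0 on (−∞, Emax]: uniform limit of the truncations
  have hucont : ContinuousOn (fun E => uf E σ 0) (Set.Iic Emax) := by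
    have hunif : TendstoUniformlyOn (fun N E => Tf E σ N 0) (fun E => uf E σ 0) atTop (Set.Iic Emax) := by
      rw [Metric.tendstoUniformlyOn_iff]
      intro δ hδ
      obtain ⟨hr0, hr1⟩ := cf_rate_lt_one hσ
      have htend : Tendsto (fun N => (1 + 4 * σ ^ 2) / (2 * σ) * (1 / (1 + 4 * σ ^ 2)) ^ N /
          (1 - 1 / (1 + 4 * σ ^ 2))) atTop
          (𝓝 ((1 + 4 * σ ^ 2) / (2 * σ) * 0 / (1 - 1 / (1 + 4 * σ ^ 2)))) :=
        ((tendsto_pow_atTop_nhds_zero_of_lt_one hr0 hr1).const_mul _).div_const _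
      rw [mul_zero, zero_div] at htend
      filter_upwards [htend.eventually_lt_const hδ] with N hN E hE
      rw [dist_comm]
      exact (cf_dist_limit (Hf E hE) hσ le_rfl (huf E hE σ hσ 0) N).trans_lt hN
    refine hunif.continuousOn (Filter.Eventually.frequently (Filter.Eventually.of_forall fun N => ?_))
    exact hTcont N 0
  -- the characteristic function G(E) = uf E σ 0 − (E/l) σ and its signs at E = 0 and E = Emax
  have hGcont : ContinuousOn (fun E => uf E σ 0 - E / l * σ) (Set.Icc 0 Emax) := by
    refine (hucont.mono fun E hE => hE.2).sub ?_
    exact ((continuous_id.div_const _).mul continuous_const).continuousOn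
  -- E = 0: positive (the tails of a positive chain are positive)
  have hG0 : 0 < uf 0 σ 0 - 0 / l * σ := by
    obtain ⟨hpos, -, -⟩ := cf_limit_props (Hf 0 hEmax0.le) hσ (huf 0 hEmax0.le σ hσ) 0
    rw [zero_div, zero_mul, sub_zero]; exact hpos
  -- E = Emax = k²/2: negative, by the first truncation u₀ ≤ 1/(σ b₀) = l/(σ k²) (hypothesis 2λ²l² < k⁴)
  have hGmax : uf Emax σ 0 - Emax / l * σ < 0 := by
    have HS := Hf Emax le_rfl
    obtain ⟨-, hle, -⟩ := cf_limit_props HS hσ (huf Emax le_rfl σ hσ) 0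
    have hb0 : βf Emax 0 = (k : ℝ) ^ 2 / l := by rw [hβf, hEmax]; push_cast; ring
    rw [hb0] at hle
    have h1 : 1 / (σ * ((k : ℝ) ^ 2 / l)) < Emax / l * σ := by
      rw [hEmax, div_lt_iff₀ (by positivity)]
      have hσ2 : σ ^ 2 = 1 / lam ^ 2 := by rw [hσdef, one_div_pow]
      have hkey : 2 * (l : ℝ) ^ 2 < σ ^ 2 * (k : ℝ) ^ 4 := by
        rw [hσ2, one_div_mul_eq_div, lt_div_iff₀ (pow_pos hlam 2)]
        linarith
      have e1 : (k : ℝ) ^ 2 / 2 / l * σ * (σ * ((k : ℝ) ^ 2 / l)) = σ ^ 2 * (k : ℝ) ^ 4 / (2 * (l : ℝ) ^ 2) := by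
        field_simp
      rw [e1, lt_div_iff₀ (by positivity)]
      linarith
    linarith
  -- intermediate value theorem on [0, Emax]
  have hmem : (0 : ℝ) ∈ Set.Icc ((fun E => uf E σ 0 - E / l * σ) Emax) ((fun E => uf E σ 0 - E / l * σ) 0) :=
    ⟨hGmax.le, hG0.le⟩
  obtain ⟨E, ⟨hE0, hEmax'⟩, hE⟩ := intermediate_value_Icc' hEmax0.le hGcont hmem
  have hE_pos : 0 < E := by
    rcases eq_or_lt_of_le hE0 with h | h
    · exfalso; rw [← h] at hE; exact absurd hE hG0.ne'
    · exact h
  have hE_lt : E < Emax := by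
    rcases eq_or_lt_of_le hEmax' with h | h
    · exfalso; rw [h] at hE; exact absurd hE hGmax.ne
    · exact h
  have hroot : uf E σ 0 = E / l * σ := sub_eq_zero.1 hE
  -- the mode and the bounds at this E
  obtain ⟨c, hc0, hdec, hmode⟩ := scalarMode_of_root (k := (k : ℝ)) hl (hβf E) (Hf E hEmax') hσ
    (huf E hEmax' σ hσ) hroot
  obtain ⟨hup, hlow⟩ := root_bounds (Hf E hEmax') hσ (huf E hEmax' σ hσ) hroot
  have hb0 : βf E 0 = 2 * ((k : ℝ) ^ 2 - E) / l := by rw [hβf]; push_cast; ring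
  have hb1 : βf E 1 = 2 * (4 * (k : ℝ) ^ 2 - E) / l := by rw [hβf]; push_cast; ring
  have hkE : 0 < 4 * (k : ℝ) ^ 2 - E := by rw [hEmax] at hE_lt; linarith
  have e : σ ^ 2 * (E / l * βf E 0) = 2 * E * ((k : ℝ) ^ 2 - E) / (lam ^ 2 * (l : ℝ) ^ 2) := by
    rw [hb0, hσdef]; field_simp
  have e' : E / l / βf E 1 = E / (2 * (4 * (k : ℝ) ^ 2 - E)) := by
    rw [hb1]; field_simp
  have hden : 0 < lam ^ 2 * (l : ℝ) ^ 2 := by positivity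
  refine ⟨E, hE_pos, by rw [hEmax] at hE_lt; linarith, ?_, ?_, c, hc0, hdec, ?_⟩
  · rw [e, div_le_one hden] at hup
    exact hup
  · rw [e, e', le_div_iff₀ hden] at hlow
    linarith
  · have : 1 / σ = lam := by rw [hσdef, one_div_one_div]
    rw [this] at hmode
    exact hmode

/-! ## 2. The eigenfunctions on the unit torus `T³`

The scalar chain modes are Fourier-side objects.  This section assembles them into classical
eigenfunctions of the passive-vector operator `Torus.passiveVectorOperator 0 ν U` on the flat unit torus
`T³ = (ℝ/ℤ)³`, for a single-harmonic unidirectional shear `U = 2|z| cos(2πk x₁ + arg z) e₀`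
(`z = Û(ke₁)₀`; the setting of `KolmogorovViscousLongWaveModes` §E).  Units: Chen–Price's
`∂ₜθ − Δθ + λ sin(ky)∂ₓθ` on `[0,2π]²` becomes the passive scalar about `U` under `x = 2πx'`,
`t = 4π²ν t'`, with `λ = A/(2πν)` (`A = 2|z|`), and a chain mode of decay rate `ρ` (plus a free spanwise
wavenumber `j`) becomes an eigenfunction with eigenvalue `μ = −4π²ν(ρ + j²)`:
`ŵ(l, mk, j) = η_m (j, 0, −l)`, `η_m = (iz/|z|)^m c_m`, pressure `0`, all other coefficients zero.
-/

section Eigen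

open scoped BigOperators ComplexConjugate
open Set Function MeasureTheory UnitAddTorus Complex
open Literature.Analysis.FunctionSpaces Literature.Analysis.FunctionSpaces.Torus
open Literature.Analysis.FunctionSpaces.EuclideanSpace
open Literature.Analysis.FluidPDE.ScalarFourier Literature.Analysis.FluidPDE.SteadyLattice
open Literature.Analysis.FluidPDE.KolmogorovShear

/-! ### 2a. The line `κ_m = (l, mk, j)` of the frequency lattice -/

/-- The frequencies `κ_m = (l, mk, j) ∈ ℤ³`. [folklore] -/
private def pvLine (l k : ℕ) (j : ℤ) (m : ℤ) : Fin 3 → ℤ := ![(l : ℤ), m * k, j]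

/-- Components of `κ_m`. [folklore] -/
@[simp] private theorem pvLine_zero (l k : ℕ) (j m : ℤ) : pvLine l k j m 0 = l := rfl
/-- Components of `κ_m`. [folklore] -/
@[simp] private theorem pvLine_one (l k : ℕ) (j m : ℤ) : pvLine l k j m 1 = m * k := rfl
/-- Components of `κ_m`. [folklore] -/
@[simp] private theorem pvLine_two (l k : ℕ) (j m : ℤ) : pvLine l k j m 2 = j := rfl

/-- The shear wave vector `k e₁ = (0, k, 0)`. [folklore] -/
private def pvShear (k : ℕ) : Fin 3 → ℤ := Pi.single 1 (k : ℤ)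

/-- Components of `k e₁`. [folklore] -/
@[simp] private theorem pvShear_zero (k : ℕ) : pvShear k 0 = 0 := by simp [pvShear]
/-- Components of `k e₁`. [folklore] -/
@[simp] private theorem pvShear_one (k : ℕ) : pvShear k 1 = k := by simp [pvShear]
/-- Components of `k e₁`. [folklore] -/
@[simp] private theorem pvShear_two (k : ℕ) : pvShear k 2 = 0 := by simp [pvShear]

/-- `m ↦ κ_m` is injective (`k ≥ 1`). [folklore] -/
private theorem pvLine_injective (l : ℕ) {k : ℕ} (hk : 1 ≤ k) (j : ℤ) : Injective (pvLine l k j) := by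
  intro m m' h
  have h1 := congrFun h 1
  simp only [pvLine_one] at h1
  have hk0 : (k : ℤ) ≠ 0 := by exact_mod_cast (show k ≠ 0 by omega)
  exact mul_right_cancel₀ hk0 h1

/-- `κ_m − k e₁ = κ_{m−1}`. [folklore] -/
private theorem pvLine_sub_shear (l k : ℕ) (j m : ℤ) : pvLine l k j m - pvShear k = pvLine l k j (m - 1) := by
  ext i; fin_cases i <;> simp [sub_mul]

/-- `κ_m + k e₁ = κ_{m+1}`. [folklore] -/
private theorem pvLine_add_shear (l k : ℕ) (j m : ℤ) : pvLine l k j m + pvShear k = pvLine l k j (m + 1) := by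
  ext i; fin_cases i <;> simp [add_mul]

/-- The line is invariant under the shift by `−k e₁`. [folklore] -/
private theorem not_mem_range_sub {l k : ℕ} {j : ℤ} {κ : Fin 3 → ℤ} (h : κ ∉ Set.range (pvLine l k j)) :
    κ - pvShear k ∉ Set.range (pvLine l k j) := by
  rintro ⟨m, hm⟩
  apply h
  refine ⟨m + 1, ?_⟩
  rw [← pvLine_add_shear, hm, sub_add_cancel]

/-- The line is invariant under the shift by `+k e₁`. [folklore] -/
private theorem not_mem_range_add {l k : ℕ} {j : ℤ} {κ : Fin 3 → ℤ} (h : κ ∉ Set.range (pvLine l k j)) :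
    κ + pvShear k ∉ Set.range (pvLine l k j) := by
  rintro ⟨m, hm⟩
  apply h
  refine ⟨m - 1, ?_⟩
  rw [← pvLine_sub_shear, hm, add_sub_cancel_right]

/-- `|κ_m|² = l² + m²k² + j²`. [folklore] -/
private theorem freqNormSq_pvLine (l k : ℕ) (j m : ℤ) :
    freqNormSq (pvLine l k j m) = (l : ℝ) ^ 2 + (m : ℝ) ^ 2 * (k : ℝ) ^ 2 + (j : ℝ) ^ 2 := by
  rw [freqNormSq, Fin.sum_univ_three]
  simp [pvLine]
  ring

/-- `κ_m ≠ 0` for `l ≥ 1`. [folklore] -/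
private theorem pvLine_ne_zero {l : ℕ} (hl : 1 ≤ l) (k : ℕ) (j m : ℤ) : pvLine l k j m ≠ 0 := by
  intro h
  have := congrFun h 0
  simp at this
  omega

/-- `0` is not on the line (`l ≥ 1`). [folklore] -/
private theorem zero_not_mem_range {l : ℕ} (hl : 1 ≤ l) (k : ℕ) (j : ℤ) :
    (0 : Fin 3 → ℤ) ∉ Set.range (pvLine l k j) := by
  rintro ⟨m, hm⟩
  exact pvLine_ne_zero hl k j m hm

/-- `k e₁ ≠ −k e₁` for `k ≥ 1`. [folklore] -/
private theorem pvShear_ne_neg {k : ℕ} (hk : 1 ≤ k) : pvShear k ≠ -pvShear k := by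
  intro h
  have h1 := congrFun h 1
  simp at h1
  omega

/-! ### 2b. Rapid decay of line-supported and of finitely supported families -/

/-- `∑_{m∈ℤ} (|m|+1)^p r^{|m|} < ∞` for `0 ≤ r < 1`. [folklore] -/
private theorem summable_pow_geom_int {r : ℝ} (hr0 : 0 ≤ r) (hr1 : r < 1) (p : ℕ) :
    Summable fun m : ℤ => ((m.natAbs : ℝ) + 1) ^ p * r ^ m.natAbs := by
  have hnat : Summable fun n : ℕ => ((n : ℝ) + 1) ^ p * r ^ n := by
    have h : ∀ j : ℕ, Summable fun n : ℕ => (n : ℝ) ^ j * r ^ n := fun j =>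
      summable_pow_mul_geometric_of_norm_lt_one j (by rw [Real.norm_eq_abs, abs_of_nonneg hr0]; exact hr1)
    have : (fun n : ℕ => ((n : ℝ) + 1) ^ p * r ^ n) =
        fun n : ℕ => ∑ j ∈ Finset.range (p + 1), ((p.choose j : ℝ) * ((n : ℝ) ^ j * r ^ n)) := by
      funext n
      rw [add_pow, Finset.sum_mul]
      refine Finset.sum_congr rfl fun j _ => ?_
      rw [one_pow, mul_one]; ring
    rw [this]
    exact summable_sum fun j _ => (h j).mul_left _
  refine summable_int_iff_summable_nat_and_neg.2 ⟨?_, ?_⟩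
  · simpa only [Int.natAbs_natCast] using hnat
  · simpa only [Int.natAbs_neg, Int.natAbs_natCast] using hnat

/-- Rapid decay of a family supported on the line `κ_m = (l, mk, j)`, with geometric decay along it.
[folklore] -/
private theorem rapidDecay_extend_line {V : Type*} [NormedAddCommGroup V] [NormedSpace ℂ V] {l k : ℕ}
    (hk : 1 ≤ k) {j : ℤ} {g : ℤ → V} {C r : ℝ} {p : ℕ} (hr0 : 0 ≤ r) (hr1 : r < 1)
    (hg : ∀ m, ‖g m‖ ≤ C * ((m.natAbs : ℝ) + 1) ^ p * r ^ m.natAbs) :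
    RapidDecay (Function.extend (pvLine l k j) g 0) := by
  intro s
  have hinj := pvLine_injective l hk j
  rw [← hinj.summable_iff (f := fun κ => (1 + freqNormSq κ) ^ s * ‖Function.extend (pvLine l k j) g 0 κ‖)]
  · -- along the line
    have hB : ∀ m : ℤ, (1 + freqNormSq (pvLine l k j m)) ≤
        (1 + (l : ℝ) ^ 2 + (k : ℝ) ^ 2 + (j : ℝ) ^ 2) * ((m.natAbs : ℝ) + 1) ^ 2 := by
      intro m
      rw [freqNormSq_pvLine]
      have hm : ((m : ℝ)) ^ 2 = (m.natAbs : ℝ) ^ 2 := by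
        rw [Nat.cast_natAbs, Int.cast_abs, sq_abs]
      rw [hm]
      have h0 : (0 : ℝ) ≤ m.natAbs := Nat.cast_nonneg _
      nlinarith [sq_nonneg (l : ℝ), sq_nonneg (k : ℝ), sq_nonneg (j : ℝ), mul_nonneg (sq_nonneg (k : ℝ)) h0,
        mul_nonneg (sq_nonneg (l : ℝ)) h0, mul_nonneg (sq_nonneg (j : ℝ)) h0, sq_nonneg ((m.natAbs : ℝ)),
        mul_nonneg (sq_nonneg (j : ℝ)) (sq_nonneg ((m.natAbs : ℝ)))]
    refine Summable.of_nonneg_of_le (fun m => mul_nonneg (one_add_freqNormSq_pow_nonneg _ _) (norm_nonneg _))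
      (fun m => ?_) (((summable_pow_geom_int hr0 hr1 (2 * s + p)).mul_left
        ((1 + (l : ℝ) ^ 2 + (k : ℝ) ^ 2 + (j : ℝ) ^ 2) ^ s * C)))
    simp only [Function.comp_apply, hinj.extend_apply]
    calc (1 + freqNormSq (pvLine l k j m)) ^ s * ‖g m‖
        ≤ ((1 + (l : ℝ) ^ 2 + (k : ℝ) ^ 2 + (j : ℝ) ^ 2) * ((m.natAbs : ℝ) + 1) ^ 2) ^ s *
            (C * ((m.natAbs : ℝ) + 1) ^ p * r ^ m.natAbs) := by
          gcongr
          · linarith [freqNormSq_nonneg (pvLine l k j m)]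
          · exact hB m
          · exact hg m
      _ = (1 + (l : ℝ) ^ 2 + (k : ℝ) ^ 2 + (j : ℝ) ^ 2) ^ s * C *
            (((m.natAbs : ℝ) + 1) ^ (2 * s + p) * r ^ m.natAbs) := by
          rw [mul_pow, ← pow_mul, pow_add]; ring
  · intro κ hκ
    rw [Function.extend_apply' _ _ _ (by rintro ⟨m, hm⟩; exact hκ ⟨m, hm⟩), Pi.zero_apply, norm_zero,
      mul_zero]

/-- A family supported at one frequency decays rapidly. [folklore] -/
private theorem rapidDecay_single {V : Type*} [NormedAddCommGroup V] [NormedSpace ℂ V]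
    (κ : Fin 3 → ℤ) (v : V) : RapidDecay (Pi.single κ v) := by
  intro s
  refine summable_of_ne_finset_zero (s := {κ}) fun κ' hκ' => ?_
  rw [Finset.mem_singleton] at hκ'
  rw [Pi.single_eq_of_ne hκ', norm_zero, mul_zero]

/-! ### 2c. From the Fourier side back to the passive-vector operator -/

/-- **The passive-vector eigen-equation from its Fourier coefficients**: if for smooth `w`, `q` the
identities `−ν4π²|κ|² ŵ(κ)_p − (N(Û,ŵ)(κ)_p + A·N(ŵ,Û)(κ)_p) − 2πi q̂(κ) κ_p − μ ŵ(κ)_p = 0` hold for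
all `κ ∈ ℤ³`, `p`, then `L_A(ν,U)(w,q) − μ w = 0` pointwise (continuity and vanishing of all Fourier
coefficients, Grafakos 2014, Prop. 3.2.4; the coefficient dictionary is
`SteadyLattice.mFourierCoeff_convect_complex`, `mFourierCoeff_stretch`, `mFourierCoeff_gradientC`,
`Torus.mFourierCoeff_laplacian`; companion of `KolmogorovViscous.linearizedNSOperator_sub_smul_eq_zero`).
[cite: Grafakos2014, Prop. 3.2.4] -/
theorem passiveVectorOperator_sub_smul_eq_zero {A ν : ℝ} {U : UnitAddTorus (Fin 3) → EuclideanSpace ℝ (Fin 3)}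
    (hU : IsSmooth U) {w : UnitAddTorus (Fin 3) → EuclideanSpace ℂ (Fin 3)} {q : UnitAddTorus (Fin 3) → ℂ}
    (hw : IsSmooth w) (hq : IsSmooth q) (μ : ℂ)
    (h : ∀ (κ : Fin 3 → ℤ) (p : Fin 3),
      -((ν * (4 * Real.pi ^ 2 * freqNormSq κ) : ℝ) : ℂ) * mFourierCoeff w κ p -
        (transportSym (fun j m => mFourierCoeff (complexify ∘ U) m j) (fun m => mFourierCoeff w m p) κ +
          (A : ℂ) * transportSym (fun j m => mFourierCoeff w m j) (fun m => mFourierCoeff (complexify ∘ U) m p) κ) -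
        2 * Real.pi * I * mFourierCoeff q κ * (κ p : ℂ) - μ * mFourierCoeff w κ p = 0) :
    ∀ x, Torus.passiveVectorOperator A ν U w q x - μ • w x = 0 := by
  have i1 : Integrable (fun y => laplacian w y) volume := hw.laplacian.integrable
  have i1' : Integrable ((ν : ℂ) • fun y => laplacian w y) volume := i1.smul (ν : ℂ)
  have i2 : Integrable (Torus.convect U w) volume := (hU.convect hw).integrable
  have i3 : Integrable (Torus.stretch w U) volume := (isSmooth_stretch hU hw).integrable
  have i3' : Integrable ((A : ℂ) • Torus.stretch w U) volume := i3.smul (A : ℂ)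
  have hgc : Continuous (Torus.gradientC q) :=
    (PiLp.continuous_toLp 2 _).comp (continuous_pi fun l => (hq.partialDeriv l).continuous)
  have i4 : Integrable (Torus.gradientC q) volume := hgc.integrable_unitAddTorus
  have i5 : Integrable (μ • w) volume := hw.integrable.smul μ
  have hfun : (fun y => Torus.passiveVectorOperator A ν U w q y - μ • w y) =
      ((ν : ℂ) • fun y => laplacian w y) - (Torus.convect U w + (A : ℂ) • Torus.stretch w U) -
        Torus.gradientC q - μ • w := by
    funext y
    simp only [Torus.passiveVectorOperator_apply, Pi.sub_apply, Pi.add_apply, Pi.smul_apply,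
      Complex.coe_smul]
  have hcont : Continuous (fun y => Torus.passiveVectorOperator A ν U w q y - μ • w y) := by
    rw [hfun]
    exact ((((hw.laplacian.continuous.const_smul (ν : ℂ)).sub
      ((hU.convect hw).continuous.add ((isSmooth_stretch hU hw).continuous.const_smul (A : ℂ)))).sub
      hgc).sub (hw.continuous.const_smul μ))
  have hzero : (fun y => Torus.passiveVectorOperator A ν U w q y - μ • w y) = 0 := by
    refine eq_zero_of_forall_mFourierCoeff_eq_zero hcont fun κ => ?_
    rw [hfun, mFourierCoeff_sub ((i1'.sub (i2.add i3')).sub i4) i5,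
      mFourierCoeff_sub (i1'.sub (i2.add i3')) i4, mFourierCoeff_sub i1' (i2.add i3'),
      mFourierCoeff_add i2 i3', mFourierCoeff_const_smul, mFourierCoeff_const_smul,
      mFourierCoeff_const_smul, mFourierCoeff_convect_complex hU hw κ, mFourierCoeff_stretch hU hw κ,
      mFourierCoeff_gradientC hq κ, show (fun y => laplacian w y) = laplacian w from rfl,
      Torus.mFourierCoeff_laplacian hw κ]
    ext p
    simp only [PiLp.sub_apply, PiLp.add_apply, PiLp.smul_apply, PiLp.neg_apply, smul_eq_mul,
      Torus.freqVec_apply, PiLp.zero_apply]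
    have := h κ p
    push_cast at this ⊢
    linear_combination this
  intro x
  exact congrFun hzero x

/-! ### 2d. The `u`-polarised eigenfunction carried by a scalar chain mode -/

/-- The polarisation `u = (j, 0, −l)`, orthogonal to every `κ_m = (l, mk, j)`. [folklore] -/
private def pvPol (l : ℕ) (j : ℤ) : Fin 3 → ℂ := ![(j : ℂ), 0, -(l : ℂ)]

/-- Components of the polarisation vector. [folklore] -/
@[simp] private theorem pvPol_zero (l : ℕ) (j : ℤ) : pvPol l j 0 = (j : ℂ) := rfl
/-- Components of the polarisation vector. [folklore] -/
@[simp] private theorem pvPol_one (l : ℕ) (j : ℤ) : pvPol l j 1 = 0 := rfl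
/-- Components of the polarisation vector. [folklore] -/
@[simp] private theorem pvPol_two (l : ℕ) (j : ℤ) : pvPol l j 2 = -(l : ℂ) := rfl

/-- `‖(j, 0, −l)‖ ≤ |j| + l`. [folklore] -/
private theorem norm_toLp_pvPol_le (l : ℕ) (j : ℤ) :
    ‖(WithLp.toLp 2 (pvPol l j) : EuclideanSpace ℂ (Fin 3))‖ ≤ (j.natAbs : ℝ) + l := by
  rw [EuclideanSpace.norm_eq, Fin.sum_univ_three]
  simp only [pvPol_zero, pvPol_one, pvPol_two, norm_neg, norm_zero, Complex.norm_natCast,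
    Complex.norm_intCast]
  have hm : |(j : ℝ)| = (j.natAbs : ℝ) := by rw [Nat.cast_natAbs, Int.cast_abs]
  rw [hm]
  have h0 : (0 : ℝ) ≤ (j.natAbs : ℝ) + l := by positivity
  calc Real.sqrt ((j.natAbs : ℝ) ^ 2 + 0 ^ 2 + (l : ℝ) ^ 2)
      ≤ Real.sqrt (((j.natAbs : ℝ) + l) ^ 2) := by
        apply Real.sqrt_le_sqrt
        nlinarith [mul_nonneg (Nat.cast_nonneg (α := ℝ) j.natAbs) (Nat.cast_nonneg (α := ℝ) l)]
    _ = (j.natAbs : ℝ) + l := Real.sqrt_sq h0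

/-- **A scalar chain mode is a pressure-free eigenfunction of the passive solenoidal vector about the
Kolmogorov layer (the oblique `2½`-dimensional reduction).** Let `U : T³ → ℝ³` be smooth with Fourier
support `{±k e₁}` and values parallel to `e₀` (`U = 2|z| cos(2πk x₁ + arg z) e₀`, `z = Û(ke₁)₀ ≠ 0`),
`ν > 0`, `1 ≤ l`, `1 ≤ k`, `j ∈ ℤ`.  If the real sequence `c` (`c₀ ≠ 0`, geometric decay) solves the
scalar chain `IsScalarMode k l λ ρ c` at the Péclet number `λ = |z|/(πν)` (`= A/(2πν)`, `A = 2|z|` the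
amplitude of `U`), then `μ = −4π²ν(ρ + j²)` is an eigenvalue of `L_0(ν, U)`: the field with Fourier
coefficients `ŵ(l, mk, j) = (iz/|z|)^m c_m (j, 0, −l)` (zero elsewhere) and the pressure `q = 0` satisfy
`νΔw − (U·∇)w − ∇q = μ w`, `div w = 0`, `∫ w = 0`, `w ≠ 0` — coefficientwise the eigen-equation IS the
chain times the fixed vector `(j, 0, −l) ⊥ κ_m`, and `(U·∇)w` generates no pressure (Kumar 2024, §5
p. 18, for `j = 0`: "the governing equation for `u₃` … becomes the advection–diffusion equation").
[cite: Kumar2024, §5 p. 18; YoshidaKaneda2000, §II eq. (4)-(5); ChenPrice1997, §2 (7)–(10)] -/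
theorem isPassiveVectorEigenvalue_of_isScalarMode {ν : ℝ} (hν : 0 < ν) {k l : ℕ} (hl : 1 ≤ l) (hk : 1 ≤ k)
    (j : ℤ) {U : UnitAddTorus (Fin 3) → EuclideanSpace ℝ (Fin 3)} (hU : IsSmooth U)
    (hsupp : ∀ m, m ≠ Pi.single 1 (k : ℤ) → m ≠ -Pi.single 1 (k : ℤ) →
      mFourierCoeff (complexify ∘ U) m = 0)
    (hdir : ∀ m (i : Fin 3), i ≠ 0 → mFourierCoeff (complexify ∘ U) m i = 0)
    (hz : mFourierCoeff (complexify ∘ U) (Pi.single 1 (k : ℤ)) 0 ≠ 0)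
    {ρ : ℝ} {c : ℤ → ℝ} (hc0 : c 0 ≠ 0)
    (hdec : ∃ K r : ℝ, 0 ≤ K ∧ 0 < r ∧ r < 1 ∧ ∀ m : ℤ, |c m| ≤ K * r ^ m.natAbs)
    (hmode : IsScalarMode k l (‖mFourierCoeff (complexify ∘ U) (Pi.single 1 (k : ℤ)) 0‖ / (Real.pi * ν)) ρ c) :
    Torus.IsPassiveVectorEigenvalue 0 ν U (((-(4 * Real.pi ^ 2 * ν * (ρ + (j : ℝ) ^ 2)) : ℝ)) : ℂ) := by
  -- names for the data of `U`; `pvShear k` is `Pi.single 1 k` by definition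
  have hcs : IsConjSymm (fun κ => mFourierCoeff (complexify ∘ U) κ) := isConjSymm_mFourierCoeff hU.integrable
  obtain ⟨a, ha⟩ : ∃ a, mFourierCoeff (complexify ∘ U) = a := ⟨_, rfl⟩
  rw [ha] at hsupp hdir hz hmode hcs
  change ∀ m, m ≠ pvShear k → m ≠ -pvShear k → a m = 0 at hsupp
  change a (pvShear k) 0 ≠ 0 at hz
  change IsScalarMode k l (‖a (pvShear k) 0‖ / (Real.pi * ν)) ρ c at hmode
  obtain ⟨z, hz'⟩ : ∃ z : ℂ, a (pvShear k) 0 = z := ⟨_, rfl⟩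
  rw [hz'] at hz hmode
  have haz : a (-pvShear k) 0 = conj z := by
    have h := hcs (pvShear k)
    dsimp only at h
    rw [h, conjVec_apply, hz']
  obtain ⟨lam, hlam⟩ : ∃ lam : ℝ, ‖z‖ / (Real.pi * ν) = lam := ⟨_, rfl⟩
  rw [hlam] at hmode
  obtain ⟨K, r, hK, hr0, hr1, hc⟩ := hdec
  have hl' : (1 : ℝ) ≤ l := by exact_mod_cast hl
  have hπ0 : Real.pi ≠ 0 := Real.pi_ne_zero
  have hzn0 : ‖z‖ ≠ 0 := norm_ne_zero_iff.2 hz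
  have hnzC : ((‖z‖ : ℝ) : ℂ) ≠ 0 := by exact_mod_cast hzn0
  -- the phase θ = iz/|z| and the complex amplitudes η_m = θ^m c_m
  obtain ⟨θ, hθ⟩ : ∃ θ : ℂ, I * z / ((‖z‖ : ℝ) : ℂ) = θ := ⟨_, rfl⟩
  have hθ0 : θ ≠ 0 := by rw [← hθ]; exact div_ne_zero (mul_ne_zero I_ne_zero hz) hnzC
  have hθn : ‖θ‖ = 1 := by
    rw [← hθ, norm_div, norm_mul, Complex.norm_I, one_mul, Complex.norm_real, Real.norm_eq_abs, abs_norm,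
      div_self hzn0]
  have hθ1 : I * z * θ⁻¹ = ((‖z‖ : ℝ) : ℂ) := by
    rw [← hθ]; field_simp
  have hθ2 : I * conj z * θ = -((‖z‖ : ℝ) : ℂ) := by
    have hzz : conj z * z = ((‖z‖ : ℝ) : ℂ) ^ 2 := Complex.conj_mul' z
    rw [← hθ, show I * conj z * (I * z / ((‖z‖ : ℝ) : ℂ)) = (I * I) * (conj z * z) / ((‖z‖ : ℝ) : ℂ) by ring,
      hzz, I_mul_I]
    field_simp
  obtain ⟨η, hη⟩ : ∃ η : ℤ → ℂ, (fun m => θ ^ m * (c m : ℂ)) = η := ⟨_, rfl⟩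
  have hηm : ∀ m, η m = θ ^ m * (c m : ℂ) := fun m => by rw [← hη]
  have hηn : ∀ m, ‖η m‖ = |c m| := fun m => by
    rw [hηm, norm_mul, norm_zpow, hθn, one_zpow, one_mul, Complex.norm_real, Real.norm_eq_abs]
  have hη0 : η 0 = (c 0 : ℂ) := by rw [hηm, zpow_zero, one_mul]
  have hηsub : ∀ m, η (m - 1) = θ ^ m * θ⁻¹ * (c (m - 1) : ℂ) := fun m => by rw [hηm, zpow_sub_one₀ hθ0]
  have hηadd : ∀ m, η (m + 1) = θ ^ m * θ * (c (m + 1) : ℂ) := fun m => by rw [hηm, zpow_add_one₀ hθ0]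
  -- the chain, complexified: (V) 4π²ν(ρ − β_m) η_m − 2πi l (z η_{m-1} + z̄ η_{m+1}) = 0
  have hV : ∀ m : ℤ, 4 * Real.pi ^ 2 * (ν : ℂ) * ((ρ : ℂ) - ((cpW k l m : ℝ) : ℂ)) * η m -
      2 * Real.pi * I * (l : ℂ) * (z * η (m - 1) + conj z * η (m + 1)) = 0 := by
    intro m
    have h := hmode m
    have hchainC : (lam : ℂ) * (l : ℂ) * ((c (m - 1) : ℂ) - (c (m + 1) : ℂ)) / 2 +
        (((cpW k l m : ℝ) : ℂ) - ρ) * (c m : ℂ) = 0 := by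
      have := congrArg (fun x : ℝ => (x : ℂ)) h
      push_cast at this
      linear_combination this
    have hνC : (ν : ℂ) ≠ 0 := by exact_mod_cast hν.ne'
    have hπC : (Real.pi : ℂ) ≠ 0 := by exact_mod_cast hπ0
    have hzn : ((‖z‖ : ℝ) : ℂ) = (lam : ℂ) * Real.pi * ν := by
      rw [← hlam]; push_cast; field_simp
    rw [hηm m, hηsub, hηadd]
    linear_combination (-(2 * Real.pi * (l : ℂ) * θ ^ m * (c (m - 1) : ℂ))) * hθ1 +
      (-(2 * Real.pi * (l : ℂ) * θ ^ m * (c (m + 1) : ℂ))) * hθ2 +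
      (-(2 * Real.pi * (l : ℂ) * θ ^ m * ((c (m - 1) : ℂ) - (c (m + 1) : ℂ)))) * hzn +
      (-(4 * Real.pi ^ 2 * (ν : ℂ) * θ ^ m)) * hchainC
  -- the coefficient family of the eigenfield
  obtain ⟨g, hg⟩ : ∃ g : ℤ → EuclideanSpace ℂ (Fin 3),
      (fun m => η m • (WithLp.toLp 2 (pvPol l j) : EuclideanSpace ℂ (Fin 3))) = g := ⟨_, rfl⟩
  have hgp : ∀ m p, g m p = η m * pvPol l j p := fun m p => by
    rw [← hg]; simp only [PiLp.smul_apply, smul_eq_mul]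
  set cf : (Fin 3 → ℤ) → EuclideanSpace ℂ (Fin 3) := Function.extend (pvLine l k j) g 0 with hcf
  have hinj := pvLine_injective l hk j
  have hc_on : ∀ m, cf (pvLine l k j m) = g m := fun m => by rw [hcf, hinj.extend_apply]
  have hc_off : ∀ κ, κ ∉ Set.range (pvLine l k j) → cf κ = 0 := fun κ hκ => by
    rw [hcf, Function.extend_apply' _ _ _ (by rintro ⟨m, hm⟩; exact hκ ⟨m, hm⟩), Pi.zero_apply]
  -- rapid decay
  have hr0' : 0 ≤ r := hr0.le
  have hcr : RapidDecay cf := by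
    refine rapidDecay_extend_line (V := EuclideanSpace ℂ (Fin 3)) hk (C := ((j.natAbs : ℝ) + l) * K) (p := 0)
      hr0' hr1 fun m => ?_
    rw [← hg]
    simp only
    rw [norm_smul, hηn, pow_zero, mul_one]
    have h1 := norm_toLp_pvPol_le l j
    have h2 := hc m
    calc |c m| * ‖(WithLp.toLp 2 (pvPol l j) : EuclideanSpace ℂ (Fin 3))‖
        ≤ (K * r ^ m.natAbs) * ((j.natAbs : ℝ) + l) :=
          mul_le_mul h2 h1 (norm_nonneg _) ((abs_nonneg _).trans h2)
      _ = ((j.natAbs : ℝ) + l) * K * r ^ m.natAbs := by ring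
  -- the eigenfield (pressure zero)
  set w : UnitAddTorus (Fin 3) → EuclideanSpace ℂ (Fin 3) := fourierSynth cf with hwdef
  have hw : IsSmooth w := hcr.isSmooth_fourierSynth
  have hwc : mFourierCoeff w = cf := funext fun κ => hcr.mFourierCoeff_fourierSynth κ
  have hq0 : ∀ κ : Fin 3 → ℤ, mFourierCoeff (fun _ : UnitAddTorus (Fin 3) => (0 : ℂ)) κ = 0 := fun κ => by
    rw [mFourierCoeff_eq_integral_volume]; simp
  refine ⟨w, ?_, hw, ?_, ?_, fun _ => 0, isSmooth_const (0 : ℂ), fun x => ?_⟩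
  · -- w ≠ 0: its coefficient at κ₀ = (l, 0, j) has third component -l c₀ ≠ 0
    intro hw0
    have h1 : mFourierCoeff w (pvLine l k j 0) = 0 := by
      rw [hw0, mFourierCoeff_eq_integral_volume]; simp
    rw [hwc, hc_on] at h1
    have h2 := congrArg (fun v : EuclideanSpace ℂ (Fin 3) => v 2) h1
    simp only [hgp, pvPol_two, PiLp.zero_apply, hη0, mul_neg, neg_eq_zero, mul_eq_zero,
      Complex.ofReal_eq_zero, Nat.cast_eq_zero] at h2
    rcases h2 with h2 | h2
    · exact hc0 h2
    · omega
  · -- div w = 0: κ_m · (j, 0, -l) = 0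
    refine isDivFreeC_of_fourier hw fun κ => ?_
    rw [hwc, Fin.sum_univ_three]
    by_cases hκ : κ ∈ Set.range (pvLine l k j)
    · obtain ⟨m, rfl⟩ := hκ
      rw [hc_on, hgp, hgp, hgp]
      simp only [pvLine_zero, pvLine_one, pvLine_two, pvPol_zero, pvPol_one, pvPol_two]
      push_cast; ring
    · rw [hc_off κ hκ]; simp
  · -- ∫ w = 0
    exact hasZeroMean_of_mFourierCoeff_zero (by rw [hwc, hc_off 0 (zero_not_mem_range hl k j)])
  · -- the equation L_0(ν,U)(w,0) = μ w, coefficientwise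
    refine passiveVectorOperator_sub_smul_eq_zero hU hw (isSmooth_const (0 : ℂ)) _ (fun κ p => ?_) x
    rw [ha, hwc, hq0, transportSym_shear_left (pvShear_ne_neg hk) (pvShear_zero k) hsupp hdir κ p, hz', haz]
    simp only [Complex.ofReal_zero, zero_mul, add_zero, mul_zero, sub_zero]
    by_cases hκ : κ ∈ Set.range (pvLine l k j)
    · obtain ⟨m, rfl⟩ := hκ
      rw [pvLine_sub_shear, pvLine_add_shear, hc_on, hc_on, hc_on, freqNormSq_pvLine]
      have hWc : ((cpW k l m : ℝ) : ℂ) = (l : ℂ) ^ 2 + (m : ℂ) ^ 2 * (k : ℂ) ^ 2 := by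
        unfold cpW; push_cast; ring
      have hVm := hV m
      rw [hWc] at hVm
      simp only [hgp, pvLine_zero, dsym_apply]
      push_cast
      linear_combination (pvPol l j p) * hVm
    · have h1 := hc_off κ hκ
      have h2 := hc_off _ (not_mem_range_sub hκ)
      have h3 := hc_off _ (not_mem_range_add hκ)
      rw [h1, h2, h3]
      simp

/-- **The passive solenoidal vector about one Kolmogorov layer has a slow real eigenvalue in the
Taylor–Zel'dovich window (exact single-layer cell coefficient, `u`-polarisation).** Let `U : T³ → ℝ³` be
smooth with Fourier support `{±k e₁}` and values parallel to `e₀` — `U(x) = A sin(2πk x₁ + φ) e₀`,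
`A = 2|Û(ke₁)₀| ≠ 0` — `ν > 0`, and put `λ = A/(2πν) = |Û(ke₁)₀|/(πν)`.  For integers `1 ≤ l`,
`2l ≤ k²`, `j`, if `2λ²l² < k⁴` then `L_0(ν, U) w = νΔw − (U·∇)w − ∇q` (`div w = 0`, `∫ w = 0`) has the
real eigenvalue `μ = −4π²ν(l² + j² + E)` with `0 < E < k²/2`, `2E(k² − E) ≤ λ²l²`,
`λ²l²(1 − E/(2(4k²−E))) ≤ 2E(k² − E)` — an exact normal mode `e^{μt} w`, `ŵ` supported on
`(l, ℤk, j)` and polarised along `(j, 0, −l)`.  Reading: the decay rate exceeds the bare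
`4π²ν(l² + j²)` by `4π²νE = (A²l²/(2νk²))(1 + O(E/k²))`, i.e. by `c_F (ê·q)²` with
`c_F = A²/(2ν k_U²)` (`k_U = 2πk` the wavenumber of the layer, `q = 2π(l,0,j)` that of the mode,
`ê = e₀`): Zel'dovich's effective diffusivity `ν + A²/(2νk_U²)` (Majda–Kramer (51)) acting on the
component of `q` along the layer velocity — relative to `|q|²` the coefficient `(ê·q̂)²` (`1` for
`j = 0`, `½` for `j = ±l`), never negative (contrast the `A = 1` anti-viscosity of
`KolmogorovViscous.exists_pos_isLinNSEigenvalue`).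
[cite: MajdaKramer1999, §2.2.1.1 eq. (50)-(51); Zeldovich1982; Kumar2024, §5 p. 18] -/
theorem exists_eigenvalue_taylorWindow {ν : ℝ} (hν : 0 < ν) {k l : ℕ} (hl : 1 ≤ l) (h2 : 2 * l ≤ k ^ 2)
    (j : ℤ) {U : UnitAddTorus (Fin 3) → EuclideanSpace ℝ (Fin 3)} (hU : IsSmooth U)
    (hsupp : ∀ m, m ≠ Pi.single 1 (k : ℤ) → m ≠ -Pi.single 1 (k : ℤ) →
      mFourierCoeff (complexify ∘ U) m = 0)
    (hdir : ∀ m (i : Fin 3), i ≠ 0 → mFourierCoeff (complexify ∘ U) m i = 0)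
    (hz : mFourierCoeff (complexify ∘ U) (Pi.single 1 (k : ℤ)) 0 ≠ 0)
    (hpe : 2 * (‖mFourierCoeff (complexify ∘ U) (Pi.single 1 (k : ℤ)) 0‖ / (Real.pi * ν)) ^ 2 * (l : ℝ) ^ 2 <
      (k : ℝ) ^ 4) :
    ∃ E : ℝ, 0 < E ∧ 2 * E < (k : ℝ) ^ 2 ∧
      2 * E * ((k : ℝ) ^ 2 - E) ≤
        (‖mFourierCoeff (complexify ∘ U) (Pi.single 1 (k : ℤ)) 0‖ / (Real.pi * ν)) ^ 2 * (l : ℝ) ^ 2 ∧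
      (‖mFourierCoeff (complexify ∘ U) (Pi.single 1 (k : ℤ)) 0‖ / (Real.pi * ν)) ^ 2 * (l : ℝ) ^ 2 *
          (1 - E / (2 * (4 * (k : ℝ) ^ 2 - E))) ≤ 2 * E * ((k : ℝ) ^ 2 - E) ∧
      Torus.IsPassiveVectorEigenvalue 0 ν U
        (((-(4 * Real.pi ^ 2 * ν * ((l : ℝ) ^ 2 + (j : ℝ) ^ 2 + E)) : ℝ)) : ℂ) := by
  have hk : 1 ≤ k := by
    rcases Nat.eq_zero_or_pos k with h | h
    · subst h; omega
    · exact h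
  have hlam : 0 < ‖mFourierCoeff (complexify ∘ U) (Pi.single 1 (k : ℤ)) 0‖ / (Real.pi * ν) :=
    div_pos (norm_pos_iff.2 hz) (mul_pos Real.pi_pos hν)
  obtain ⟨E, hE, hE2, hup, hlow, c, hc0, hdec, hmode⟩ := exists_scalarMode_of_lt hl h2 hlam hpe
  refine ⟨E, hE, hE2, hup, hlow, ?_⟩
  have h := isPassiveVectorEigenvalue_of_isScalarMode hν hl hk j hU hsupp hdir hz hc0 hdec hmode
  have e : (l : ℝ) ^ 2 + E + (j : ℝ) ^ 2 = (l : ℝ) ^ 2 + (j : ℝ) ^ 2 + E := by ring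
  rw [e] at h
  exact h

/-! ### 2e. The transverse sector `κ₀ = 0`: bare decay, no enhancement -/

/-- **Modes transverse to the layer velocity are untouched.** For a smooth `U : T³ → ℝ³` with values
parallel to `e₀` (any profile), `ν ∈ ℝ`, a frequency `κ ≠ 0` with `κ₀ = 0` and a polarisation
`v ∈ ℂ³ ∖ 0` with `κ · v = 0`, the single Fourier mode `w = e^{2πiκ·x} v` satisfies
`νΔw − (U·∇)w = −4π²ν|κ|² w` with pressure `0`: in the sector `q ⊥ ê` the passive solenoidal vector
about a unidirectional field decays at the bare rate (cell coefficient `0`; `(U·∇)w = 2πi(U·κ)w = 0`).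
[cite: MajdaKramer1999, §2.2.1.1 eq. (50) (no enhancement transverse to the shear); YoshidaKaneda2000, §II eq. (4)-(5)] -/
theorem isPassiveVectorEigenvalue_transverse (ν : ℝ) {U : UnitAddTorus (Fin 3) → EuclideanSpace ℝ (Fin 3)}
    (hU : IsSmooth U) (hdir : ∀ m (i : Fin 3), i ≠ 0 → mFourierCoeff (complexify ∘ U) m i = 0)
    {κ : Fin 3 → ℤ} (hκ : κ ≠ 0) (hκ0 : κ 0 = 0) {v : EuclideanSpace ℂ (Fin 3)} (hv : v ≠ 0)
    (hperp : ∑ i, ((κ i : ℤ) : ℂ) * v i = 0) :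
    Torus.IsPassiveVectorEigenvalue 0 ν U (((-(4 * Real.pi ^ 2 * ν * freqNormSq κ) : ℝ)) : ℂ) := by
  set cf : (Fin 3 → ℤ) → EuclideanSpace ℂ (Fin 3) := Pi.single κ v with hcf
  have hcr : RapidDecay cf := rapidDecay_single κ v
  set w : UnitAddTorus (Fin 3) → EuclideanSpace ℂ (Fin 3) := fourierSynth cf with hwdef
  have hw : IsSmooth w := hcr.isSmooth_fourierSynth
  have hwc : mFourierCoeff w = cf := funext fun κ' => hcr.mFourierCoeff_fourierSynth κ'
  have hq0 : ∀ κ' : Fin 3 → ℤ, mFourierCoeff (fun _ : UnitAddTorus (Fin 3) => (0 : ℂ)) κ' = 0 := fun κ' => by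
    rw [mFourierCoeff_eq_integral_volume]; simp
  have hc_on : cf κ = v := by rw [hcf, Pi.single_eq_same]
  have hc_off : ∀ κ', κ' ≠ κ → cf κ' = 0 := fun κ' h => by rw [hcf, Pi.single_eq_of_ne h]
  refine ⟨w, ?_, hw, ?_, ?_, fun _ => 0, isSmooth_const (0 : ℂ), fun x => ?_⟩
  · intro hw0
    have h1 : mFourierCoeff w κ = 0 := by
      rw [hw0, mFourierCoeff_eq_integral_volume]; simp
    rw [hwc, hc_on] at h1
    exact hv h1
  · refine isDivFreeC_of_fourier hw fun κ' => ?_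
    rw [hwc]
    by_cases h : κ' = κ
    · rw [h, hc_on]; exact hperp
    · rw [hc_off κ' h]; simp
  · exact hasZeroMean_of_mFourierCoeff_zero (by rw [hwc, hc_off 0 (Ne.symm hκ)])
  · refine passiveVectorOperator_sub_smul_eq_zero hU hw (isSmooth_const (0 : ℂ)) _ (fun κ' p => ?_) x
    -- the convective symbol: every term carries the factor κ''₀ ĉ(κ'')_p, which vanishes for ĉ = δ_κ v, κ₀ = 0
    have hT : transportSym (fun j m => mFourierCoeff (complexify ∘ U) m j) (fun m => mFourierCoeff w m p) κ' = 0 := by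
      rw [transportSym_apply, Fin.sum_univ_three]
      have h0 : ∀ jj : Fin 3, jj ≠ 0 →
          lconv (fun m => mFourierCoeff (complexify ∘ U) m jj) (fun m => dsym jj m * mFourierCoeff w m p) κ' = 0 :=
        fun jj hjj => by rw [lconv_apply]; simp [hdir _ jj hjj]
      have hterm : ∀ m : Fin 3 → ℤ, mFourierCoeff (complexify ∘ U) m 0 *
          (dsym 0 (κ' - m) * mFourierCoeff w (κ' - m) p) = 0 := by
        intro m
        rw [hwc]
        by_cases h : κ' - m = κ
        · rw [h, dsym_apply, hκ0]; simp
        · rw [hc_off _ h]; simp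
      rw [h0 1 one_ne_zero, h0 2 (by decide), add_zero, add_zero, lconv_apply]
      simp only [hterm, tsum_zero]
    rw [hT, hwc, hq0]
    simp only [Complex.ofReal_zero, zero_mul, add_zero, mul_zero, sub_zero]
    by_cases h : κ' = κ
    · rw [h, hc_on]; push_cast; ring
    · rw [hc_off κ' h]; simp

/-! ### 2f. The window in sandwich form -/

/-- **The Taylor window in sandwich form.** If `0 < E`, `2E < k²`, `2E(k² − E) ≤ λ²l²` and
`λ²l²(1 − E/(2(4k² − E))) ≤ 2E(k² − E)` (the window of `exists_scalarMode_of_lt` /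
`exists_eigenvalue_taylorWindow`), then `(13/28)·λ²l²/k² ≤ E ≤ λ²l²/k²`: the enhancement is comparable,
within the factors `13/14` and `2`, to Zel'dovich's leading-order value `λ²l²/(2k²)` (Majda–Kramer (51)).
[cite: MajdaKramer1999, §2.2.1.1 eq. (51) (leading-order value of the enhancement)] -/
theorem taylorWindow_sandwich {k l lam E : ℝ} (hk : 0 < k) (hE : 0 < E) (hE2 : 2 * E < k ^ 2)
    (hup : 2 * E * (k ^ 2 - E) ≤ lam ^ 2 * l ^ 2)
    (hlow : lam ^ 2 * l ^ 2 * (1 - E / (2 * (4 * k ^ 2 - E))) ≤ 2 * E * (k ^ 2 - E)) :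
    13 / 28 * (lam ^ 2 * l ^ 2) / k ^ 2 ≤ E ∧ E ≤ lam ^ 2 * l ^ 2 / k ^ 2 := by
  have hk2 : 0 < k ^ 2 := by positivity
  have h4 : 0 < 4 * k ^ 2 - E := by linarith
  constructor
  · have hθ : E / (2 * (4 * k ^ 2 - E)) ≤ 1 / 14 := by
      rw [div_le_div_iff₀ (by positivity) (by norm_num)]
      linarith
    have hll : 0 ≤ lam ^ 2 * l ^ 2 := by positivity
    have h1 : lam ^ 2 * l ^ 2 * (13 / 14) ≤ 2 * E * (k ^ 2 - E) :=
      le_trans (mul_le_mul_of_nonneg_left (by linarith) hll) hlow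
    rw [div_le_iff₀ hk2]
    nlinarith [h1, sq_nonneg E]
  · rw [le_div_iff₀ hk2]
    nlinarith [hup, mul_nonneg hE.le (show (0 : ℝ) ≤ k ^ 2 - 2 * E by linarith)]

/-- **Headline, sandwich form.** Under the hypotheses of `exists_eigenvalue_taylorWindow` the passive
solenoidal vector about the layer `U = A sin(2πk x₁ + φ) e₀` has, for every spanwise `j`, a real
eigenvalue `−4π²ν(l² + j² + E)` whose enhancement satisfies `(13/28)·λ²l²/k² ≤ E ≤ λ²l²/k²`,
`λ = A/(2πν)` — i.e. the decay rate exceeds the bare `4π²ν(l² + j²)` by an amount between `13/14` and `2`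
times the Zel'dovich–Taylor value `A²l²/(2νk²)` (effective diffusivity `ν + A²/(2ν k_U²)`, `k_U = 2πk`,
Majda–Kramer (51)). [cite: MajdaKramer1999, §2.2.1.1 eq. (50)-(51); Zeldovich1982; Kumar2024, §5 p. 18] -/
theorem exists_eigenvalue_taylorSandwich {ν : ℝ} (hν : 0 < ν) {k l : ℕ} (hl : 1 ≤ l) (h2 : 2 * l ≤ k ^ 2)
    (j : ℤ) {U : UnitAddTorus (Fin 3) → EuclideanSpace ℝ (Fin 3)} (hU : IsSmooth U)
    (hsupp : ∀ m, m ≠ Pi.single 1 (k : ℤ) → m ≠ -Pi.single 1 (k : ℤ) →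
      mFourierCoeff (complexify ∘ U) m = 0)
    (hdir : ∀ m (i : Fin 3), i ≠ 0 → mFourierCoeff (complexify ∘ U) m i = 0)
    (hz : mFourierCoeff (complexify ∘ U) (Pi.single 1 (k : ℤ)) 0 ≠ 0)
    (hpe : 2 * (‖mFourierCoeff (complexify ∘ U) (Pi.single 1 (k : ℤ)) 0‖ / (Real.pi * ν)) ^ 2 * (l : ℝ) ^ 2 <
      (k : ℝ) ^ 4) :
    ∃ E : ℝ,
      13 / 28 * ((‖mFourierCoeff (complexify ∘ U) (Pi.single 1 (k : ℤ)) 0‖ / (Real.pi * ν)) ^ 2 * (l : ℝ) ^ 2) /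
          (k : ℝ) ^ 2 ≤ E ∧
      E ≤ (‖mFourierCoeff (complexify ∘ U) (Pi.single 1 (k : ℤ)) 0‖ / (Real.pi * ν)) ^ 2 * (l : ℝ) ^ 2 /
          (k : ℝ) ^ 2 ∧
      Torus.IsPassiveVectorEigenvalue 0 ν U
        (((-(4 * Real.pi ^ 2 * ν * ((l : ℝ) ^ 2 + (j : ℝ) ^ 2 + E)) : ℝ)) : ℂ) := by
  have hk : 1 ≤ k := by
    rcases Nat.eq_zero_or_pos k with h | h
    · subst h; omega
    · exact h
  have hk' : (0 : ℝ) < k := by exact_mod_cast hk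
  obtain ⟨E, hE, hE2, hup, hlow, heig⟩ := exists_eigenvalue_taylorWindow hν hl h2 j hU hsupp hdir hz hpe
  obtain ⟨hlo, hhi⟩ := taylorWindow_sandwich hk' hE hE2 hup hlow
  exact ⟨E, hlo, hhi, heig⟩


end Eigen


/-! ## 3. No negative eddy viscosity at `A = 0`: the energy identity at the level of normal modes

For the passive solenoidal vector `d/dt ½‖w‖² = −ν‖∇w‖²` (the convective term is skew, there is no
stretching term), so a normal mode decays at least at the bare viscous rate of its gravest Fourier
component — for either polarisation, at every amplitude.  At the level of the two chains (complex rate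
`ρ`, complex coefficients): multiplying the `m`-th equation by `conj c_m` and summing over `m`, the
coupling terms telescope into `conj S − S ∈ iℝ`, whence `Re ρ · Σ_m e_m|c_m|² = Σ_m a_m|c_m|²` with
`(a_m, e_m) = (β_m, 1)` (scalar chain) or `(β_m², β_m)` (in-plane chain), and `Re ρ ≥ l² = min_m β_m`.
Contrast `KolmogorovViscous.exists_growingMode` (`A = 1`: growing modes above the Meshalkin–Sinai
threshold). -/

section Energy

open scoped ComplexConjugate
open Complex

/-- The scalar chain with complex decay rate and complex coefficients. [cite: MajdaKramer1999, §2.2.1.1 eq. (49); ChenPrice1997, §2 (9)] -/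
def IsScalarModeC (k l lam : ℝ) (ρ : ℂ) (c : ℤ → ℂ) : Prop :=
  ∀ m : ℤ, (lam : ℂ) * l * (c (m - 1) - c (m + 1)) / 2 + (((cpW k l m : ℝ) : ℂ) - ρ) * c m = 0

/-- The in-plane chain with complex decay rate and complex coefficients. [cite: Kumar2024, §1; YoshidaKaneda2000, §II eq. (4)-(5)] -/
def IsInPlaneModeC (k l lam : ℝ) (ρ : ℂ) (η : ℤ → ℂ) : Prop :=
  ∀ m : ℤ, (lam : ℂ) * l * (((bond k l ((m : ℝ) - 1) : ℝ) : ℂ) * η (m - 1) -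
      ((bond k l m : ℝ) : ℂ) * η (m + 1)) / 2 +
    ((cpW k l m : ℝ) : ℂ) * (((cpW k l m : ℝ) : ℂ) - ρ) * η m = 0

/-- A real scalar mode is a complex one. [cite: ChenPrice1997, §2 (9)] -/
theorem isScalarModeC_of_isScalarMode {k l lam ρ : ℝ} {c : ℤ → ℝ} (h : IsScalarMode k l lam ρ c) :
    IsScalarModeC k l lam ρ (fun m => (c m : ℂ)) := by
  intro m
  have := congrArg (fun x : ℝ => (x : ℂ)) (h m)
  push_cast at this ⊢
  linear_combination this

/-- A real in-plane mode is a complex one. [cite: Kumar2024, §1] -/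
theorem isInPlaneModeC_of_isInPlaneMode {k l lam ρ : ℝ} {η : ℤ → ℝ} (h : IsInPlaneMode k l lam ρ η) :
    IsInPlaneModeC k l lam ρ (fun m => (η m : ℂ)) := by
  intro m
  have := congrArg (fun x : ℝ => (x : ℂ)) (h m)
  push_cast at this ⊢
  linear_combination this

/-- Summability of `f_m z_{m+s} conj z_m` for an exponentially localised `z` and a weight `f` of
polynomial growth. [folklore] -/
private theorem summable_weight_mul {z : ℤ → ℂ} {K r : ℝ} (hr0 : 0 < r) (hr1 : r < 1)
    (hz : ∀ m, ‖z m‖ ≤ K * r ^ m.natAbs) {f : ℤ → ℂ} {C : ℝ} {p : ℕ} (hC : 0 ≤ C)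
    (hf : ∀ m, ‖f m‖ ≤ C * ((m.natAbs : ℝ) + 1) ^ p) (s : ℤ) :
    Summable fun m => f m * (z (m + s) * conj (z m)) := by
  have hK : 0 ≤ K := by
    have h := hz 0
    simp only [Int.natAbs_zero, pow_zero, mul_one] at h
    exact (norm_nonneg _).trans h
  refine Summable.of_norm_bounded (g := fun m => C * K * K * (((m.natAbs : ℝ) + 1) ^ p * r ^ m.natAbs))
    ((summable_pow_geom_int hr0.le hr1 p).mul_left _) fun m => ?_
  have h1 : ‖z (m + s)‖ ≤ K :=
    (hz (m + s)).trans (mul_le_of_le_one_right hK (pow_le_one₀ hr0.le hr1.le))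
  have h2 := hz m
  have h3 := hf m
  calc ‖f m * (z (m + s) * conj (z m))‖ = ‖f m‖ * (‖z (m + s)‖ * ‖z m‖) := by
        rw [norm_mul, norm_mul, Complex.norm_conj]
    _ ≤ (C * ((m.natAbs : ℝ) + 1) ^ p) * (K * (K * r ^ m.natAbs)) :=
        mul_le_mul h3 (mul_le_mul h1 h2 (norm_nonneg _) hK) (mul_nonneg (norm_nonneg _) (norm_nonneg _))
          (mul_nonneg hC (by positivity))
    _ = C * K * K * (((m.natAbs : ℝ) + 1) ^ p * r ^ m.natAbs) := by ring

/-- `(|m| + 1)²` dominates `m²` (real casts). [folklore] -/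
private theorem intCast_sq_le (m : ℤ) : (m : ℝ) ^ 2 ≤ ((m.natAbs : ℝ) + 1) ^ 2 := by
  have hm : ((m : ℝ)) ^ 2 = (m.natAbs : ℝ) ^ 2 := by rw [Nat.cast_natAbs, Int.cast_abs, sq_abs]
  rw [hm]
  nlinarith [Nat.cast_nonneg (α := ℝ) m.natAbs]

/-- `β_m = l² + m²k² ≤ (l² + k²)(|m|+1)²`. [folklore] -/
private theorem cpW_le (k l : ℝ) (m : ℤ) : cpW k l m ≤ (l ^ 2 + k ^ 2) * ((m.natAbs : ℝ) + 1) ^ 2 := by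
  unfold cpW
  have h1 := intCast_sq_le m
  have h2 : (1 : ℝ) ≤ ((m.natAbs : ℝ) + 1) ^ 2 := by nlinarith [Nat.cast_nonneg (α := ℝ) m.natAbs]
  nlinarith [sq_nonneg k, sq_nonneg l, mul_le_mul_of_nonneg_right h1 (sq_nonneg k),
    mul_le_mul_of_nonneg_left h2 (sq_nonneg l)]

/-- `β_m ≥ 0`. [folklore] -/
private theorem cpW_nonneg (k l : ℝ) (m : ℤ) : 0 ≤ cpW k l m := by unfold cpW; positivity

/-- `|γ_m| = |l² + m(m+1)k²| ≤ (l² + k²)(|m|+1)²`. [folklore] -/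
private theorem abs_bond_le (k l : ℝ) (m : ℤ) : |bond k l m| ≤ (l ^ 2 + k ^ 2) * ((m.natAbs : ℝ) + 1) ^ 2 := by
  unfold bond
  have hm : |(m : ℝ)| = (m.natAbs : ℝ) := by rw [Nat.cast_natAbs, Int.cast_abs]
  have h0 : (0 : ℝ) ≤ m.natAbs := Nat.cast_nonneg _
  have hprod : |(m : ℝ) * ((m : ℝ) + 1)| ≤ ((m.natAbs : ℝ) + 1) ^ 2 := by
    rw [abs_mul]
    have ha : |(m : ℝ) + 1| ≤ (m.natAbs : ℝ) + 1 := by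
      calc |(m : ℝ) + 1| ≤ |(m : ℝ)| + |1| := abs_add_le _ _
        _ = (m.natAbs : ℝ) + 1 := by rw [hm, abs_one]
    calc |(m : ℝ)| * |(m : ℝ) + 1| ≤ (m.natAbs : ℝ) * ((m.natAbs : ℝ) + 1) := by
          rw [hm]; exact mul_le_mul_of_nonneg_left ha h0
      _ ≤ ((m.natAbs : ℝ) + 1) ^ 2 := by nlinarith
  have h2 : (1 : ℝ) ≤ ((m.natAbs : ℝ) + 1) ^ 2 := by nlinarith
  calc |l ^ 2 + (m : ℝ) * ((m : ℝ) + 1) * k ^ 2| ≤ |l ^ 2| + |(m : ℝ) * ((m : ℝ) + 1) * k ^ 2| :=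
        abs_add_le _ _
    _ = l ^ 2 + |(m : ℝ) * ((m : ℝ) + 1)| * k ^ 2 := by
        rw [abs_of_nonneg (sq_nonneg l), abs_mul, abs_of_nonneg (sq_nonneg k)]
    _ ≤ l ^ 2 * ((m.natAbs : ℝ) + 1) ^ 2 + ((m.natAbs : ℝ) + 1) ^ 2 * k ^ 2 :=
        add_le_add (le_mul_of_one_le_right (sq_nonneg l) h2) (mul_le_mul_of_nonneg_right hprod (sq_nonneg k))
    _ = (l ^ 2 + k ^ 2) * ((m.natAbs : ℝ) + 1) ^ 2 := by ring

/-- **The energy identity at the level of a three-term chain.** If `z ∈ ℂ^ℤ` solves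
`g_{m−1} z_{m−1} − g_m z_{m+1} + (a_m − ρ e_m) z_m = 0` with real weights and the three series below
converge, then `Re ρ · Σ e_m|z_m|² = Σ a_m|z_m|²` (multiply by `conj z_m`, sum, and note that the
coupling terms telescope into `conj S − S ∈ iℝ`, `S = Σ g_m z_{m+1} conj z_m`). [folklore] -/
private theorem re_mul_tsum_eq_of_chain {a e g : ℤ → ℝ} {ρ : ℂ} {z : ℤ → ℂ}
    (hchain : ∀ m : ℤ, ((g (m - 1) : ℂ) * z (m - 1) - (g m : ℂ) * z (m + 1)) +
      ((a m : ℂ) - ρ * (e m : ℂ)) * z m = 0)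
    (ha : Summable fun m => (a m : ℂ) * (z m * conj (z m)))
    (he : Summable fun m => (e m : ℂ) * (z m * conj (z m)))
    (hg : Summable fun m => (g m : ℂ) * (z (m + 1) * conj (z m))) :
    ρ.re * (∑' m, e m * ‖z m‖ ^ 2) = ∑' m, a m * ‖z m‖ ^ 2 := by
  -- the coupling terms: P_m = g_m z_{m+1} conj z_m, Q_m = g_{m-1} z_{m-1} conj z_m = conj P_{m-1}
  obtain ⟨P, hP⟩ : ∃ P : ℤ → ℂ, (fun m => (g m : ℂ) * (z (m + 1) * conj (z m))) = P := ⟨_, rfl⟩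
  obtain ⟨Q, hQ⟩ : ∃ Q : ℤ → ℂ, (fun m => (g (m - 1) : ℂ) * (z (m - 1) * conj (z m))) = Q := ⟨_, rfl⟩
  have hPm : ∀ m, P m = (g m : ℂ) * (z (m + 1) * conj (z m)) := fun m => by rw [← hP]
  have hQm : ∀ m, Q m = (g (m - 1) : ℂ) * (z (m - 1) * conj (z m)) := fun m => by rw [← hQ]
  have hQP : ∀ m, Q m = conj (P (m - 1)) := by
    intro m
    rw [hQm, hPm, map_mul, map_mul, Complex.conj_ofReal, Complex.conj_conj, sub_add_cancel]
    ring
  have hPs : Summable P := by rw [← hP]; exact hg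
  have hQs : Summable Q := by
    have h1 : Summable fun m => P (m - 1) := (Equiv.subRight (1 : ℤ)).summable_iff.2 hPs
    have h2 : Summable fun m => conj (P (m - 1)) := (Complex.conjCLE.summable (f := fun m => P (m - 1))).2 h1
    exact h2.congr fun m => (hQP m).symm
  have hQsum : ∑' m, Q m = conj (∑' m, P m) := by
    rw [Complex.conj_tsum, ← (Equiv.subRight (1 : ℤ)).tsum_eq (fun m => conj (P m))]
    exact tsum_congr fun m => hQP m
  -- the diagonal terms as real series
  obtain ⟨Ar, hAr⟩ : ∃ Ar : ℤ → ℝ, (fun m => a m * ‖z m‖ ^ 2) = Ar := ⟨_, rfl⟩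
  obtain ⟨Er, hEr⟩ : ∃ Er : ℤ → ℝ, (fun m => e m * ‖z m‖ ^ 2) = Er := ⟨_, rfl⟩
  have hArm : ∀ m, (a m : ℂ) * (z m * conj (z m)) = ((Ar m : ℝ) : ℂ) := fun m => by
    rw [← hAr, Complex.mul_conj']; push_cast; ring
  have hErm : ∀ m, (e m : ℂ) * (z m * conj (z m)) = ((Er m : ℝ) : ℂ) := fun m => by
    rw [← hEr, Complex.mul_conj']; push_cast; ring
  have hAs : Summable fun m => ((Ar m : ℝ) : ℂ) := ha.congr hArm
  have hEs : Summable fun m => ((Er m : ℝ) : ℂ) := he.congr hErm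
  -- the m-th identity times conj z_m, summed
  have hterm : ∀ m, ((Ar m : ℝ) : ℂ) - ρ * ((Er m : ℝ) : ℂ) + Q m - P m = 0 := by
    intro m
    have h := congrArg (fun x => x * conj (z m)) (hchain m)
    simp only [zero_mul] at h
    rw [← hArm, ← hErm, hQm, hPm]
    linear_combination h
  have hsum : (∑' m, ((Ar m : ℝ) : ℂ)) - ρ * (∑' m, ((Er m : ℝ) : ℂ)) + (∑' m, Q m) - (∑' m, P m) = 0 := by
    have h1 : ∑' m, (((Ar m : ℝ) : ℂ) - ρ * ((Er m : ℝ) : ℂ) + Q m - P m) = 0 := by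
      simp only [hterm, tsum_zero]
    rw [← h1, ((hAs.sub (hEs.mul_left ρ)).add hQs).tsum_sub hPs, (hAs.sub (hEs.mul_left ρ)).tsum_add hQs,
      hAs.tsum_sub (hEs.mul_left ρ), tsum_mul_left]
  rw [hQsum, ← Complex.ofReal_tsum, ← Complex.ofReal_tsum] at hsum
  have h2 := congrArg Complex.re hsum
  simp only [Complex.sub_re, Complex.add_re, Complex.mul_re, Complex.ofReal_re, Complex.ofReal_im,
    Complex.conj_re, mul_zero, sub_zero, Complex.zero_re] at h2
  rw [hAr, hEr]
  linarith

/-- **No negative eddy viscosity for the `u`-polarisation (scalar chain): every exponentially localised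
mode decays at least at the bare rate `l²`.** If `c ≢ 0`, `|c_m| ≤ K r^{|m|}` (`0 < r < 1`), solves the
scalar chain with complex rate `ρ` at any amplitude `λ`, then `Re ρ ≥ l²`; precisely
`Re ρ · Σ|c_m|² = Σ (l² + m²k²)|c_m|²`.  This is the energy identity of the passive solenoidal vector
(Kumar 2024 §1: `U·∇u` skew, `−∇p` orthogonal to divergence-free fields) restricted to one normal mode;
at `A = 1` it fails (`KolmogorovViscous.exists_growingMode`).
[cite: MajdaKramer1999, §2.2.1.1 eq. (49)-(50) (the shear never reduces the diffusivity); Kumar2024, §1] -/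
theorem sq_le_re_of_isScalarModeC {k l lam : ℝ} {ρ : ℂ} {c : ℤ → ℂ} (hmode : IsScalarModeC k l lam ρ c)
    (hdec : ∃ K r : ℝ, 0 < r ∧ r < 1 ∧ ∀ m : ℤ, ‖c m‖ ≤ K * r ^ m.natAbs) (hc : ∃ m, c m ≠ 0) :
    l ^ 2 ≤ ρ.re := by
  obtain ⟨K, r, hr0, hr1, hcm⟩ := hdec
  -- the chain in the normal form of `re_mul_tsum_eq_of_chain`: g ≡ λl/2, a = β, e = 1
  have hchain : ∀ m : ℤ, (((lam * l / 2 : ℝ) : ℂ) * c (m - 1) - ((lam * l / 2 : ℝ) : ℂ) * c (m + 1)) +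
      (((cpW k l m : ℝ) : ℂ) - ρ * ((1 : ℝ) : ℂ)) * c m = 0 := by
    intro m
    have h := hmode m
    push_cast at h ⊢
    linear_combination h
  have hlk : 0 ≤ l ^ 2 + k ^ 2 := by positivity
  have ha : Summable fun m : ℤ => ((cpW k l m : ℝ) : ℂ) * (c m * conj (c m)) := by
    have h := summable_weight_mul hr0 hr1 hcm (f := fun m : ℤ => ((cpW k l m : ℝ) : ℂ)) (p := 2) hlk
      (fun m => by
        rw [Complex.norm_real, Real.norm_eq_abs, abs_of_nonneg (cpW_nonneg k l m)]
        exact cpW_le k l m) 0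
    simpa only [add_zero] using h
  have he : Summable fun m : ℤ => ((1 : ℝ) : ℂ) * (c m * conj (c m)) := by
    have h := summable_weight_mul hr0 hr1 hcm (f := fun _ => ((1 : ℝ) : ℂ)) (p := 0) zero_le_one
      (fun m => by simp) 0
    simpa only [add_zero] using h
  have hg : Summable fun m : ℤ => ((lam * l / 2 : ℝ) : ℂ) * (c (m + 1) * conj (c m)) :=
    summable_weight_mul hr0 hr1 hcm (f := fun _ => ((lam * l / 2 : ℝ) : ℂ)) (p := 0) (abs_nonneg (lam * l / 2))
      (fun m => by rw [Complex.norm_real, Real.norm_eq_abs, pow_zero, mul_one]) 1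
  have hid := re_mul_tsum_eq_of_chain (a := fun m : ℤ => cpW k l m) (e := fun _ => (1 : ℝ))
    (g := fun _ => lam * l / 2) hchain ha he hg
  simp only [one_mul] at hid
  -- real summability of the two diagonal series and positivity of Σ|c|²
  have hEs : Summable fun m : ℤ => ‖c m‖ ^ 2 := by
    refine Complex.summable_ofReal.1 (he.congr fun m => ?_)
    rw [Complex.mul_conj']; push_cast; ring
  have hAs : Summable fun m : ℤ => cpW k l m * ‖c m‖ ^ 2 := by
    refine Complex.summable_ofReal.1 (ha.congr fun m => ?_)
    rw [Complex.mul_conj']; push_cast; ring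
  obtain ⟨m0, hm0⟩ := hc
  have hpos : 0 < ∑' m, ‖c m‖ ^ 2 :=
    hEs.tsum_pos (fun m => sq_nonneg _) m0 (by positivity)
  have hle : l ^ 2 * ∑' m, ‖c m‖ ^ 2 ≤ ∑' m : ℤ, cpW k l m * ‖c m‖ ^ 2 := by
    rw [← tsum_mul_left]
    refine Summable.tsum_le_tsum (fun m => ?_) (hEs.mul_left _) hAs
    exact mul_le_mul_of_nonneg_right (by unfold cpW; nlinarith [sq_nonneg ((m : ℝ) * k)]) (sq_nonneg _)
  rw [← hid] at hle
  exact le_of_mul_le_mul_right hle hpos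

/-- **No negative eddy viscosity for the in-plane polarisation either.** If `η ≢ 0`, exponentially
localised, solves the in-plane chain with complex rate `ρ` (any amplitude `λ`, `l ≠ 0`), then
`Re ρ ≥ l²`; precisely `Re ρ · Σ β_m|η_m|² = Σ β_m²|η_m|²` (`β_m|η_m|²` is the energy of the Fourier
component `η_m (mk, −l)`).  Energy identity of the passive solenoidal vector at the level of one
normal mode. [cite: Kumar2024, §1 (the passive-vector model: skew advection, pressure orthogonal to solenoidal fields); YoshidaKaneda2000, §II eq. (4)-(5)] -/
theorem sq_le_re_of_isInPlaneModeC {k l lam : ℝ} (hl : l ≠ 0) {ρ : ℂ} {η : ℤ → ℂ}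
    (hmode : IsInPlaneModeC k l lam ρ η)
    (hdec : ∃ K r : ℝ, 0 < r ∧ r < 1 ∧ ∀ m : ℤ, ‖η m‖ ≤ K * r ^ m.natAbs) (hη : ∃ m, η m ≠ 0) :
    l ^ 2 ≤ ρ.re := by
  obtain ⟨K, r, hr0, hr1, hηm⟩ := hdec
  -- normal form: g_m = (λl/2) γ_m, a_m = β_m², e_m = β_m
  have hchain : ∀ m : ℤ, (((lam * l / 2 * bond k l ((m : ℝ) - 1) : ℝ) : ℂ) * η (m - 1) -
      ((lam * l / 2 * bond k l m : ℝ) : ℂ) * η (m + 1)) +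
      (((cpW k l m ^ 2 : ℝ) : ℂ) - ρ * ((cpW k l m : ℝ) : ℂ)) * η m = 0 := by
    intro m
    have h := hmode m
    push_cast at h ⊢
    linear_combination h
  have hlk : 0 ≤ l ^ 2 + k ^ 2 := by positivity
  have ha : Summable fun m : ℤ => ((cpW k l m ^ 2 : ℝ) : ℂ) * (η m * conj (η m)) := by
    have h := summable_weight_mul hr0 hr1 hηm (f := fun m : ℤ => ((cpW k l m ^ 2 : ℝ) : ℂ)) (p := 4)
      (C := (l ^ 2 + k ^ 2) ^ 2) (by positivity)
      (fun m => by
        rw [Complex.norm_real, Real.norm_eq_abs, abs_of_nonneg (sq_nonneg _),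
          show ((m.natAbs : ℝ) + 1) ^ 4 = (((m.natAbs : ℝ) + 1) ^ 2) ^ 2 by ring, ← mul_pow]
        exact pow_le_pow_left₀ (cpW_nonneg k l m) (cpW_le k l m) 2) 0
    simpa only [add_zero] using h
  have he : Summable fun m : ℤ => ((cpW k l m : ℝ) : ℂ) * (η m * conj (η m)) := by
    have h := summable_weight_mul hr0 hr1 hηm (f := fun m : ℤ => ((cpW k l m : ℝ) : ℂ)) (p := 2) hlk
      (fun m => by
        rw [Complex.norm_real, Real.norm_eq_abs, abs_of_nonneg (cpW_nonneg k l m)]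
        exact cpW_le k l m) 0
    simpa only [add_zero] using h
  have hg : Summable fun m : ℤ => ((lam * l / 2 * bond k l m : ℝ) : ℂ) * (η (m + 1) * conj (η m)) := by
    refine summable_weight_mul hr0 hr1 hηm (f := fun m : ℤ => ((lam * l / 2 * bond k l m : ℝ) : ℂ)) (p := 2)
      (C := |lam * l / 2| * (l ^ 2 + k ^ 2)) (by positivity) (fun m => ?_) 1
    rw [Complex.norm_real, Real.norm_eq_abs, abs_mul, mul_assoc]
    exact mul_le_mul_of_nonneg_left (abs_bond_le k l m) (abs_nonneg _)
  have hchain' : ∀ m : ℤ, (((fun m : ℤ => lam * l / 2 * bond k l m) (m - 1) : ℝ) : ℂ) * η (m - 1) -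
      (((fun m : ℤ => lam * l / 2 * bond k l m) m : ℝ) : ℂ) * η (m + 1) +
      ((((fun m : ℤ => cpW k l m ^ 2) m : ℝ) : ℂ) - ρ * (((fun m : ℤ => cpW k l m) m : ℝ) : ℂ)) * η m = 0 := by
    intro m
    have h := hchain m
    simp only [Int.cast_sub, Int.cast_one] at h ⊢
    exact h
  have hid := re_mul_tsum_eq_of_chain (a := fun m : ℤ => cpW k l m ^ 2) (e := fun m : ℤ => cpW k l m)
    (g := fun m : ℤ => lam * l / 2 * bond k l m) hchain' ha he hg
  -- real summability, positivity of Σ β|η|², comparison β² ≥ l² β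
  have hEs : Summable fun m : ℤ => cpW k l m * ‖η m‖ ^ 2 := by
    refine Complex.summable_ofReal.1 (he.congr fun m => ?_)
    rw [Complex.mul_conj']; push_cast; ring
  have hAs : Summable fun m : ℤ => cpW k l m ^ 2 * ‖η m‖ ^ 2 := by
    refine Complex.summable_ofReal.1 (ha.congr fun m => ?_)
    rw [Complex.mul_conj']; push_cast; ring
  have hl2 : 0 < l ^ 2 := by positivity
  have hWpos : ∀ m : ℤ, 0 < cpW k l m := fun m => by
    unfold cpW; nlinarith [sq_nonneg ((m : ℝ) * k)]
  obtain ⟨m0, hm0⟩ := hη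
  have hpos : 0 < ∑' m : ℤ, cpW k l m * ‖η m‖ ^ 2 :=
    hEs.tsum_pos (fun m => mul_nonneg (cpW_nonneg k l m) (sq_nonneg _)) m0
      (mul_pos (hWpos m0) (by positivity))
  have hle : l ^ 2 * ∑' m : ℤ, cpW k l m * ‖η m‖ ^ 2 ≤ ∑' m : ℤ, cpW k l m ^ 2 * ‖η m‖ ^ 2 := by
    rw [← tsum_mul_left]
    refine Summable.tsum_le_tsum (fun m => ?_) (hEs.mul_left _) hAs
    have hW : l ^ 2 ≤ cpW k l m := by unfold cpW; nlinarith [sq_nonneg ((m : ℝ) * k)]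
    calc l ^ 2 * (cpW k l m * ‖η m‖ ^ 2) = l ^ 2 * cpW k l m * ‖η m‖ ^ 2 := by ring
      _ ≤ cpW k l m * cpW k l m * ‖η m‖ ^ 2 :=
          mul_le_mul_of_nonneg_right (mul_le_mul_of_nonneg_right hW (hWpos m).le) (sq_nonneg _)
      _ = cpW k l m ^ 2 * ‖η m‖ ^ 2 := by ring
  rw [← hid] at hle
  exact le_of_mul_le_mul_right hle hpos

end Energy


end KolmogorovPassiveVector

end Literature.Analysis.FluidPDE

end
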